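import Literature.NumberTheory.LFunctions.SatheSelbergRieszMeans
import Literature.NumberTheory.LFunctions.SatheSelbergProofs
import Mathlib.Analysis.SpecialFunctions.Stirling
import Mathlib.MeasureTheory.Integral.CircleIntegral
import Literature.Analysis.Complex.HolomorphicParametricIntegral
import HarnessLib

/-!
# The Sathe–Selberg formula for `ω` (Montgomery–Vaughan §7.4.1 Exercise 3(c)): unconditional proof

This file DISCHARGES the named fact
`Literature.NumberTheory.LFunctions.MontgomeryVaughan2007_exercise_7_4_3c` (`SatheSelberg.lean`):
`theorem MontgomeryVaughan2007_exercise_7_4_3c_holds`. Everything here is PROVED.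

Relation to the tree: `SatheSelbergProofs.lean` derives the fact from Selberg's (sharp) mean value
formula for `z^{ω(n)}` taken as a hypothesis, and `SatheSelbergFromSelbergDelange.lean` reduces that
hypothesis to the named fact `MontgomeryVaughan2007_thm_7_18` (the general Selberg–Delange theorem,
not proved in the tree). The present file needs NO unproved input: instead of the sharp sums of
Theorem 7.18 it uses the Riesz-smoothed Selberg–Delange asymptotic
`SatheSelberg.rieszMean_omegaCoeff_asymp` (`SatheSelbergRieszMeans.lean`, proved from the classical
zero-free region, the bounds for `log ζ` there and Hankel's loop integral) and runs
Montgomery–Vaughan's proof of Theorem 7.19 (p. 180) on SHORT-DIFFERENCE means, de-smoothing only at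
the very end by positivity (`ρ_k` is monotone in `x`):

1. From the Riesz means `I_z(y) = ∑_{n ≤ y} z^{ω(n)}(y − n)` we pass to the short-difference means
   `W_z(x) = (I_z(x(1+h)) − I_z(x))/(hx) = ∑_n z^{ω(n)} φ(n)` (`φ = 1` on `n ≤ x`, `φ = 0` beyond
   `x(1+h)`, linear in between), `h ≍ (log log x)^{−3}`:
   `W_z(x) = z G(z) x (log x)^{z−1} (1 + h/2) + O_R(x (log x)^{Re z − 2}/h)`, `G(z) = F(1,z)/Γ(z+1)`
   (`shortMean_asymp`).
2. Cauchy's coefficient formula on `|z| = r`, `r = (k−1)/log log x` (`k ≥ 2`; radius `1/log log x`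
   for `k = 1`), with MV's second-order Taylor decomposition of `G` at `r` (the linear term integrates
   to `0` precisely for this `r`, `circleIntegral_linear_term_eq_zero`), the bound
   `∫ (1 − cos θ) e^{(k−1)cos θ} dθ ≪ e^{k−1}(k−1)^{−3/2}` (`integral_one_sub_cos_mul_exp_le`) and
   Stirling's formula (`SatheSelberg.factorial_mul_exp_le` of `SatheSelbergProofs.lean`), gives
   `W_k(x) = M_k(x)(1 + O_R(k/(log log x)²))`, `M_k(x) = G(r) x (log log x)^{k−1}/((k−1)! log x)`
   (`shortCoeff_asymp`).
3. `ρ_k(x)` is sandwiched: `W_k(x/(1+h)) ≤ ρ_k(x) ≤ W_k(x)` (`shortCoeff_le_card`,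
   `card_le_shortCoeff`), and `M_k(x/(1+h)) = M_k(x)(1 + O(h))` (`count_lower`, `count_upper`).
4. The Euler product `F(1, r)` is replaced by its truncation `∏_{p ≤ x}` (`satheSelbergF x r`) at
   relative cost `O_R(x^{−1/2})` (`SatheSelbergEulerProductAtOne.lean`).

## References

* [MontgomeryVaughan2007] H. L. Montgomery, R. C. Vaughan, *Multiplicative Number Theory I*,
  CUP 2007, §7.4 Theorem 7.19 and its proof (p. 180), §7.4.1 Exercise 3 (c).
-/

noncomputable section

open Complex Set MeasureTheory Filter Topology Metric intervalIntegral Finset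
open scoped Real Interval

namespace Literature.NumberTheory.LFunctions

namespace SatheSelberg

open scoped ArithmeticFunction.omega

/-! ### The Selberg–Delange asymptotic in the variable `y` -/

/-- **`I_z(y) = F(1,z) y² (log y)^{z−1}/(2Γ(z)) + O_R(y²(log y)^{Re z − 2})`** for real `y ≥ y₀`.
[cite: MontgomeryVaughan2007, Theorems 7.17–7.18] -/
theorem rieszMean_asymp (R : ℝ) (hR : 0 < R) :
    ∃ C : ℝ, 0 ≤ C ∧ ∃ y₀ : ℝ, 3 ≤ y₀ ∧ ∀ y : ℝ, y₀ ≤ y → ∀ z : ℂ, ‖z‖ ≤ R →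
      ‖(∑ n ∈ Finset.Ioc 0 ⌊y⌋₊, omegaCoeff z n * ((y : ℂ) - n)) -
        selbergF 1 z / (2 * Complex.Gamma z) * (y : ℂ) ^ 2 * (Real.log y : ℂ) ^ (z - 1)‖ ≤
        C * y ^ 2 * Real.log y ^ (z.re - 2) := by
  obtain ⟨C, hC, L₀, hL₀, h⟩ := rieszMean_omegaCoeff_asymp R hR
  refine ⟨C, hC, max 3 (Real.exp L₀), le_max_left _ _, fun y hy z hz ↦ ?_⟩
  have hy3 : 3 ≤ y := le_trans (le_max_left _ _) hy
  have hy0 : 0 < y := by linarith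
  have hL : L₀ ≤ Real.log y := by
    rw [Real.le_log_iff_exp_le hy0]; exact le_trans (le_max_right _ _) hy
  have h' := h (Real.log y) hL z hz
  rwa [Real.exp_log hy0] at h'

/-! ### The short-difference means `W_z(x)` as finite sums -/

/-- The weight `φ(n) = ((x(1+h) − n) − (x − n)₊)/(hx)` of the short-difference mean. [folklore] -/
theorem weight_eq_one {x h : ℝ} (hx : 0 < x) (hh : 0 < h) {n : ℕ} (hn : (n : ℝ) ≤ x) :
    ((x * (1 + h) - n) - max (x - n) 0) / (h * x) = 1 := by
  rw [max_eq_left (by linarith), div_eq_one_iff_eq (by positivity)]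
  ring

/-- The weight lies in `[0, 1]` for `n ≤ x(1+h)`. [folklore] -/
theorem weight_mem_Icc {x h : ℝ} (hx : 0 < x) (hh : 0 < h) {n : ℕ} (hn : (n : ℝ) ≤ x * (1 + h)) :
    ((x * (1 + h) - n) - max (x - n) 0) / (h * x) ∈ Set.Icc (0 : ℝ) 1 := by
  have hhx : 0 < h * x := by positivity
  constructor
  · refine div_nonneg ?_ hhx.le
    rcases le_or_gt (x - n) 0 with h1 | h1
    · rw [max_eq_right h1]; linarith
    · rw [max_eq_left h1.le]; nlinarith
  · rw [div_le_one hhx]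
    rcases le_or_gt (x - n) 0 with h1 | h1
    · rw [max_eq_right h1]; nlinarith
    · rw [max_eq_left h1.le]; nlinarith

/-- The Riesz mean as a sum over the larger range with the weight `(x − n)₊`. [folklore] -/
theorem rieszMean_eq_sum_posPart (z : ℂ) {x x' : ℝ} (hx : 0 ≤ x) (hxx' : x ≤ x') :
    ∑ n ∈ Finset.Ioc 0 ⌊x⌋₊, omegaCoeff z n * ((x : ℂ) - n) =
      ∑ n ∈ Finset.Ioc 0 ⌊x'⌋₊, omegaCoeff z n * ((max (x - n) 0 : ℝ) : ℂ) := by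
  have hsub : Finset.Ioc 0 ⌊x⌋₊ ⊆ Finset.Ioc 0 ⌊x'⌋₊ :=
    Finset.Ioc_subset_Ioc_right (Nat.floor_le_floor hxx')
  rw [← Finset.sum_subset hsub]
  · refine Finset.sum_congr rfl fun n hn ↦ ?_
    rw [Finset.mem_Ioc] at hn
    have hnx : (n : ℝ) ≤ x := (Nat.cast_le.2 hn.2).trans (Nat.floor_le hx)
    rw [max_eq_left (sub_nonneg.2 hnx)]; push_cast; ring
  · intro n hn hn'
    rw [Finset.mem_Ioc, not_and_or, not_lt, not_le] at hn'
    rw [Finset.mem_Ioc] at hn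
    rcases hn' with h | h
    · omega
    · have : x < n := by exact_mod_cast Nat.lt_of_floor_lt h
      rw [max_eq_right (by linarith)]; simp

/-- **`W_z(x) = ∑_n z^{ω(n)} φ(n)`**: the short-difference mean is a finite weighted sum with weights
in `[0,1]`, equal to `1` for `n ≤ x`. [cite: MontgomeryVaughan2007, §7.4 (7.61)] -/
theorem shortMean_eq_sum (z : ℂ) {x h : ℝ} (hx : 0 < x) (hh : 0 < h) :
    ((∑ n ∈ Finset.Ioc 0 ⌊x * (1 + h)⌋₊, omegaCoeff z n * (((x * (1 + h) : ℝ) : ℂ) - n)) -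
      ∑ n ∈ Finset.Ioc 0 ⌊x⌋₊, omegaCoeff z n * ((x : ℂ) - n)) / (((h * x : ℝ)) : ℂ) =
      ∑ n ∈ Finset.Ioc 0 ⌊x * (1 + h)⌋₊, omegaCoeff z n *
        (((((x * (1 + h) - n) - max (x - n) 0) / (h * x) : ℝ)) : ℂ) := by
  have hxx' : x ≤ x * (1 + h) := by nlinarith
  rw [rieszMean_eq_sum_posPart z hx.le hxx', ← Finset.sum_sub_distrib, Finset.sum_div]
  refine Finset.sum_congr rfl fun n _ ↦ ?_
  push_cast
  ring

/-- The coefficient `W_k(x, h) = ∑_{n ≤ x(1+h), ω(n) = k} φ(n)` of `z^k` in `W_z(x)`. We write it as a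
filtered sum. The sandwich `ρ_k(x) ≤ W_k(x,h)`: [cite: MontgomeryVaughan2007, §7.4 p. 180] -/
theorem card_le_shortCoeff {x : ℕ} (hx : 0 < x) {h : ℝ} (hh : 0 < h) (k : ℕ) :
    (distinctPrimeFactorCount x k : ℝ) ≤
      ∑ n ∈ (Finset.Ioc 0 ⌊(x : ℝ) * (1 + h)⌋₊).filter (fun n ↦ ω n = k),
        (((x : ℝ) * (1 + h) - n) - max ((x : ℝ) - n) 0) / (h * x) := by
  have hxr : (0 : ℝ) < x := by exact_mod_cast hx
  rw [distinctPrimeFactorCount]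
  have hsub : (Finset.Icc 1 x).filter (fun n : ℕ ↦ ω n = k) ⊆
      (Finset.Ioc 0 ⌊(x : ℝ) * (1 + h)⌋₊).filter (fun n ↦ ω n = k) := by
    intro n hn
    rw [Finset.mem_filter, Finset.mem_Icc] at hn
    rw [Finset.mem_filter, Finset.mem_Ioc]
    refine ⟨⟨hn.1.1, ?_⟩, hn.2⟩
    refine Nat.le_floor ?_
    have : (n : ℝ) ≤ x := by exact_mod_cast hn.1.2
    nlinarith
  calc (((Finset.Icc 1 x).filter (fun n : ℕ ↦ ω n = k)).card : ℝ)
      = ∑ n ∈ (Finset.Icc 1 x).filter (fun n : ℕ ↦ ω n = k), (1 : ℝ) := by simp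
    _ = ∑ n ∈ (Finset.Icc 1 x).filter (fun n : ℕ ↦ ω n = k),
          (((x : ℝ) * (1 + h) - n) - max ((x : ℝ) - n) 0) / (h * x) := by
        refine Finset.sum_congr rfl fun n hn ↦ ?_
        rw [Finset.mem_filter, Finset.mem_Icc] at hn
        rw [weight_eq_one hxr hh (by exact_mod_cast hn.1.2)]
    _ ≤ _ := Finset.sum_le_sum_of_subset_of_nonneg hsub fun n hn _ ↦ by
        rw [Finset.mem_filter, Finset.mem_Ioc] at hn
        exact (weight_mem_Icc hxr hh (Nat.floor_le (by positivity) |>.trans' (by exact_mod_cast hn.1.2))).1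

/-- The sandwich `W_k(x/(1+h), h) ≤ ρ_k(x)` (for the mean whose long end is exactly `x`).
[cite: MontgomeryVaughan2007, §7.4 p. 180] -/
theorem shortCoeff_le_card {x : ℕ} (hx : 0 < x) {h : ℝ} (hh : 0 < h) (k : ℕ) :
    ∑ n ∈ (Finset.Ioc 0 ⌊((x : ℝ) / (1 + h)) * (1 + h)⌋₊).filter (fun n ↦ ω n = k),
        ((((x : ℝ) / (1 + h)) * (1 + h) - n) - max ((x : ℝ) / (1 + h) - n) 0) / (h * ((x : ℝ) / (1 + h))) ≤
      (distinctPrimeFactorCount x k : ℝ) := by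
  have hxr : (0 : ℝ) < x := by exact_mod_cast hx
  have hx' : 0 < (x : ℝ) / (1 + h) := by positivity
  have hxe : (x : ℝ) / (1 + h) * (1 + h) = x := by field_simp
  rw [distinctPrimeFactorCount, hxe, Nat.floor_natCast]
  have hset : (Finset.Ioc 0 x).filter (fun n ↦ ω n = k) = (Finset.Icc 1 x).filter (fun n : ℕ ↦ ω n = k) := by
    rfl
  rw [hset]
  calc ∑ n ∈ (Finset.Icc 1 x).filter (fun n : ℕ ↦ ω n = k),
        (((x : ℝ) - n) - max ((x : ℝ) / (1 + h) - n) 0) / (h * ((x : ℝ) / (1 + h)))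
      ≤ ∑ n ∈ (Finset.Icc 1 x).filter (fun n : ℕ ↦ ω n = k), (1 : ℝ) := by
        refine Finset.sum_le_sum fun n hn ↦ ?_
        rw [Finset.mem_filter, Finset.mem_Icc] at hn
        have h := (weight_mem_Icc hx' hh (n := n) (by rw [hxe]; exact_mod_cast hn.1.2)).2
        rwa [hxe] at h
    _ = _ := by simp


/-! ### The short-difference means: asymptotic (step 1 of the proof of MV Theorem 7.19) -/

/-- `‖(1 + u)^w − 1‖ ≤ 2‖w‖u` for `u ≥ 0`, `‖w‖ u ≤ 1/2` (positive real base). [folklore] -/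
theorem norm_one_add_cpow_sub_one_le {u : ℝ} (hu : 0 ≤ u) {w : ℂ} (h : ‖w‖ * u ≤ 1 / 2) :
    ‖((1 + u : ℝ) : ℂ) ^ w - 1‖ ≤ 2 * ‖w‖ * u := by
  have h1u : 0 < 1 + u := by linarith
  rw [cpow_def_of_ne_zero (ofReal_ne_zero.2 h1u.ne'), ← ofReal_log h1u.le]
  have hlog : Real.log (1 + u) ≤ u := by
    have := Real.log_le_sub_one_of_pos h1u; linarith
  have hlog0 : 0 ≤ Real.log (1 + u) := Real.log_nonneg (by linarith)
  have hζ : ‖((Real.log (1 + u) : ℝ) : ℂ) * w‖ ≤ ‖w‖ * u := by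
    rw [norm_mul, Complex.norm_real, Real.norm_of_nonneg hlog0, mul_comm]
    exact mul_le_mul_of_nonneg_left hlog (norm_nonneg _)
  calc ‖exp (((Real.log (1 + u) : ℝ) : ℂ) * w) - 1‖ ≤ 2 * ‖((Real.log (1 + u) : ℝ) : ℂ) * w‖ :=
        norm_exp_sub_one_le (by linarith)
    _ ≤ 2 * (‖w‖ * u) := by linarith
    _ = 2 * ‖w‖ * u := by ring

/-- `(1 + u)^c ≤ 2^{|c|}` for `u ∈ [0, 1]`. [folklore] -/
theorem one_add_rpow_le {u c : ℝ} (hu0 : 0 ≤ u) (hu1 : u ≤ 1) : (1 + u) ^ c ≤ (2 : ℝ) ^ |c| := by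
  rcases le_or_gt 0 c with hc | hc
  · rw [abs_of_nonneg hc]
    exact Real.rpow_le_rpow (by linarith) (by linarith) hc
  · rw [abs_of_neg hc]
    calc (1 + u) ^ c ≤ (1 : ℝ) ^ c := Real.rpow_le_rpow_of_nonpos (by norm_num) (by linarith) hc.le
      _ = 1 := Real.one_rpow c
      _ ≤ 2 ^ (-c) := Real.one_le_rpow (by norm_num) (by linarith)

/-- **Asymptotic for the short-difference means** (MV p. 180, first step, in smoothed form):
for `x ≥ x₀(R)`, `0 < h ≤ 1`, `‖z‖ ≤ R`,
`‖W_z(x) − (1 + h/2) (F(1,z)/Γ(z)) x (log x)^{z−1}‖ ≤ C x (log x)^{Re z − 2}/h`.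
[cite: MontgomeryVaughan2007, §7.4 p. 180] -/
theorem shortMean_asymp (R : ℝ) (hR : 0 < R) :
    ∃ C : ℝ, 0 ≤ C ∧ ∃ x₀ : ℝ, 3 ≤ x₀ ∧ ∀ x : ℝ, x₀ ≤ x → ∀ h : ℝ, 0 < h → h ≤ 1 → ∀ z : ℂ, ‖z‖ ≤ R →
      ‖((∑ n ∈ Finset.Ioc 0 ⌊x * (1 + h)⌋₊, omegaCoeff z n * (((x * (1 + h) : ℝ) : ℂ) - n)) -
          ∑ n ∈ Finset.Ioc 0 ⌊x⌋₊, omegaCoeff z n * ((x : ℂ) - n)) / (((h * x : ℝ)) : ℂ) -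
        (1 + h / 2 : ℂ) * (selbergF 1 z / Complex.Gamma z) * x * (Real.log x : ℂ) ^ (z - 1)‖ ≤
        C * x * Real.log x ^ (z.re - 2) / h := by
  obtain ⟨C, hC, y₀, hy₀, hI⟩ := rieszMean_asymp R hR
  obtain ⟨B, hB, hFb⟩ := exists_bound_selbergF (by norm_num : (1 : ℝ) / 2 < 3 / 4) R
  -- `1/Γ` is entire, hence bounded on `‖z‖ ≤ R`
  obtain ⟨MΓ, hMΓ, hΓ⟩ : ∃ M : ℝ, 0 ≤ M ∧ ∀ z : ℂ, ‖z‖ ≤ R → ‖(Complex.Gamma z)⁻¹‖ ≤ M := by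
    obtain ⟨M, hM⟩ := (isCompact_closedBall (0 : ℂ) R).exists_bound_of_continuousOn
      (Complex.differentiable_one_div_Gamma.continuous.continuousOn)
    exact ⟨max M 0, le_max_right _ _, fun z hz ↦ (hM z (by simpa using hz)).trans (le_max_left _ _)⟩
  refine ⟨8 * (R + 1) * (B * MΓ / 2) + C * (4 * 2 ^ (R + 2) + 1), by positivity,
    max y₀ (Real.exp (2 * (R + 1))), le_trans hy₀ (le_max_left _ _), fun x hx h hh hh1 z hz ↦ ?_⟩
  have hxy₀ : y₀ ≤ x := le_trans (le_max_left _ _) hx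
  have hx3 : 3 ≤ x := le_trans hy₀ hxy₀
  have hx0 : 0 < x := by linarith
  set ℓ : ℝ := Real.log x with hℓ
  have hℓge : 2 * (R + 1) ≤ ℓ := by
    rw [hℓ, Real.le_log_iff_exp_le hx0]; exact le_trans (le_max_right _ _) hx
  have hℓ1 : 1 ≤ ℓ := by linarith
  have hℓ0 : 0 < ℓ := by linarith
  set y₁ : ℝ := x * (1 + h) with hy₁
  have hy₁x : x ≤ y₁ := by rw [hy₁]; nlinarith
  have hy₁0 : 0 < y₁ := by linarith
  set ℓ₁ : ℝ := Real.log y₁ with hℓ₁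
  set u : ℝ := Real.log (1 + h) / ℓ with hu
  have hlog1h : 0 ≤ Real.log (1 + h) := Real.log_nonneg (by linarith)
  have hlog1h' : Real.log (1 + h) ≤ h := by
    have := Real.log_le_sub_one_of_pos (by linarith : 0 < 1 + h); linarith
  have hu0 : 0 ≤ u := div_nonneg hlog1h hℓ0.le
  have huh : u ≤ h / ℓ := div_le_div_of_nonneg_right hlog1h' hℓ0.le
  have hu1 : u ≤ 1 := by
    calc u ≤ h / ℓ := huh
      _ ≤ 1 := by rw [div_le_one hℓ0]; linarith
  have hℓ₁eq : ℓ₁ = ℓ * (1 + u) := by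
    have hℓne : ℓ ≠ 0 := hℓ0.ne'
    have e : ℓ * (1 + u) = ℓ + Real.log (1 + h) := by rw [hu]; field_simp
    rw [e, hℓ₁, hy₁, Real.log_mul hx0.ne' (by linarith), hℓ]
  have h1u : 0 < 1 + u := by linarith
  have hℓ₁0 : 0 < ℓ₁ := by rw [hℓ₁eq]; positivity
  -- the two Selberg–Delange approximations
  set A : ℂ := selbergF 1 z / (2 * Complex.Gamma z) with hA
  have hA2 : selbergF 1 z / Complex.Gamma z = 2 * A := by rw [hA]; ring
  have hAnorm : ‖A‖ ≤ B * MΓ / 2 := by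
    rw [hA, div_eq_mul_inv, mul_inv, norm_mul, norm_mul, norm_inv, norm_inv, Complex.norm_two]
    have h1 := hFb 1 z (by norm_num) hz
    have h2 := hΓ z hz
    rw [norm_inv] at h2
    calc ‖selbergF 1 z‖ * (2⁻¹ * ‖Complex.Gamma z‖⁻¹) = ‖selbergF 1 z‖ * ‖Complex.Gamma z‖⁻¹ / 2 := by ring
      _ ≤ B * MΓ / 2 := by gcongr
  have hE₀ := hI x hxy₀ z hz
  have hE₁ := hI y₁ (hxy₀.trans hy₁x) z hz
  rw [← hA] at hE₀ hE₁
  set S₀ : ℂ := ∑ n ∈ Finset.Ioc 0 ⌊x⌋₊, omegaCoeff z n * ((x : ℂ) - n) with hS₀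
  set S₁ : ℂ := ∑ n ∈ Finset.Ioc 0 ⌊y₁⌋₊, omegaCoeff z n * ((y₁ : ℂ) - n) with hS₁
  -- `ℓ₁^{z-1} = ℓ^{z-1} q`, `q = (1+u)^{z-1}`
  set q : ℂ := ((1 + u : ℝ) : ℂ) ^ (z - 1) with hq
  have hℓ₁pow : (ℓ₁ : ℂ) ^ (z - 1) = (ℓ : ℂ) ^ (z - 1) * q := by
    rw [hℓ₁eq, hq, show ((ℓ * (1 + u) : ℝ) : ℂ) = (ℓ : ℂ) * ((1 + u : ℝ) : ℂ) by push_cast; ring]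
    exact mul_cpow_ofReal_nonneg hℓ0.le h1u.le (z - 1)
  have hq1 : ‖q - 1‖ ≤ 2 * (R + 1) * u := by
    have hw : ‖z - 1‖ ≤ R + 1 := (norm_sub_le _ _).trans (by rw [norm_one]; linarith)
    have hwu : ‖z - 1‖ * u ≤ 1 / 2 := by
      calc ‖z - 1‖ * u ≤ (R + 1) * (h / ℓ) := mul_le_mul hw huh hu0 (by linarith)
        _ ≤ (R + 1) * (1 / ℓ) := by gcongr
        _ ≤ 1 / 2 := by rw [mul_one_div, div_le_iff₀ hℓ0]; linarith
    calc ‖q - 1‖ ≤ 2 * ‖z - 1‖ * u := norm_one_add_cpow_sub_one_le hu0 hwu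
      _ ≤ 2 * (R + 1) * u := by gcongr
  -- the algebraic decomposition
  have hhx : (((h * x : ℝ)) : ℂ) ≠ 0 := ofReal_ne_zero.2 (by positivity)
  have hhc : (h : ℂ) ≠ 0 := ofReal_ne_zero.2 hh.ne'
  have hxc : (x : ℂ) ≠ 0 := ofReal_ne_zero.2 hx0.ne'
  have key : (S₁ - S₀) / (((h * x : ℝ)) : ℂ) -
      (1 + h / 2 : ℂ) * (selbergF 1 z / Complex.Gamma z) * x * (ℓ : ℂ) ^ (z - 1) =
      ((S₁ - A * (y₁ : ℂ) ^ 2 * (ℓ₁ : ℂ) ^ (z - 1)) - (S₀ - A * (x : ℂ) ^ 2 * (ℓ : ℂ) ^ (z - 1))) /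
        (((h * x : ℝ)) : ℂ) +
      A * x * (ℓ : ℂ) ^ (z - 1) * (1 + h) ^ 2 * (q - 1) / h := by
    rw [hA2, hℓ₁pow, hy₁]
    push_cast
    field_simp
    ring
  rw [key]
  -- bounds
  have hnorm₀ : ‖S₀ - A * (x : ℂ) ^ 2 * (ℓ : ℂ) ^ (z - 1)‖ ≤ C * x ^ 2 * ℓ ^ (z.re - 2) := hE₀
  have hnorm₁ : ‖S₁ - A * (y₁ : ℂ) ^ 2 * (ℓ₁ : ℂ) ^ (z - 1)‖ ≤ C * y₁ ^ 2 * ℓ₁ ^ (z.re - 2) := hE₁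
  have hℓ₁re : ℓ₁ ^ (z.re - 2) ≤ 2 ^ (R + 2) * ℓ ^ (z.re - 2) := by
    rw [hℓ₁eq, Real.mul_rpow hℓ0.le h1u.le, mul_comm]
    refine mul_le_mul_of_nonneg_right ?_ (Real.rpow_nonneg hℓ0.le _)
    refine (one_add_rpow_le hu0 hu1).trans (Real.rpow_le_rpow_of_exponent_le (by norm_num) ?_)
    have := abs_re_le_norm z
    rw [abs_le] at this ⊢
    constructor <;> linarith [this.1, this.2]
  have hy₁2 : y₁ ^ 2 ≤ 4 * x ^ 2 := by
    have h4 : (1 + h) ^ 2 ≤ 4 := by nlinarith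
    calc y₁ ^ 2 = x ^ 2 * (1 + h) ^ 2 := by rw [hy₁]; ring
      _ ≤ x ^ 2 * 4 := by gcongr
      _ = 4 * x ^ 2 := by ring
  have hfirst : ‖((S₁ - A * (y₁ : ℂ) ^ 2 * (ℓ₁ : ℂ) ^ (z - 1)) - (S₀ - A * (x : ℂ) ^ 2 * (ℓ : ℂ) ^ (z - 1))) /
      (((h * x : ℝ)) : ℂ)‖ ≤ C * (4 * 2 ^ (R + 2) + 1) * x * ℓ ^ (z.re - 2) / h := by
    rw [norm_div, Complex.norm_real, Real.norm_of_nonneg (by positivity)]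
    rw [div_le_div_iff₀ (by positivity) hh]
    have hℓre0 : 0 ≤ ℓ ^ (z.re - 2) := Real.rpow_nonneg hℓ0.le _
    calc ‖(S₁ - A * (y₁ : ℂ) ^ 2 * (ℓ₁ : ℂ) ^ (z - 1)) - (S₀ - A * (x : ℂ) ^ 2 * (ℓ : ℂ) ^ (z - 1))‖ * h
        ≤ (C * y₁ ^ 2 * ℓ₁ ^ (z.re - 2) + C * x ^ 2 * ℓ ^ (z.re - 2)) * h :=
          mul_le_mul_of_nonneg_right ((norm_sub_le _ _).trans (add_le_add hnorm₁ hnorm₀)) hh.le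
      _ ≤ (C * (4 * x ^ 2) * (2 ^ (R + 2) * ℓ ^ (z.re - 2)) + C * x ^ 2 * ℓ ^ (z.re - 2)) * h := by
          gcongr
      _ = C * (4 * 2 ^ (R + 2) + 1) * x * ℓ ^ (z.re - 2) * (h * x) := by ring
  have hsecond : ‖A * x * (ℓ : ℂ) ^ (z - 1) * (1 + h) ^ 2 * (q - 1) / h‖ ≤
      8 * (R + 1) * (B * MΓ / 2) * x * ℓ ^ (z.re - 2) / h := by
    rw [norm_div, norm_mul, norm_mul, norm_mul, norm_mul, Complex.norm_real, Real.norm_of_nonneg hx0.le,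
      norm_cpow_eq_rpow_re_of_pos hℓ0, sub_re, one_re, Complex.norm_real, Real.norm_of_nonneg hh.le]
    have h14 : ‖(1 + h : ℂ) ^ 2‖ ≤ 4 := by
      rw [norm_pow, show (1 + h : ℂ) = ((1 + h : ℝ) : ℂ) by push_cast; ring, Complex.norm_real,
        Real.norm_of_nonneg (by linarith)]
      nlinarith
    refine div_le_div_of_nonneg_right ?_ hh.le
    have hℓre1 : 0 ≤ ℓ ^ (z.re - 1) := Real.rpow_nonneg hℓ0.le _
    have hℓre2 : 0 ≤ ℓ ^ (z.re - 2) := Real.rpow_nonneg hℓ0.le _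
    have hq' : ‖q - 1‖ ≤ 2 * (R + 1) * (h / ℓ) := hq1.trans (by gcongr)
    calc ‖A‖ * x * ℓ ^ (z.re - 1) * ‖(1 + (h : ℂ)) ^ 2‖ * ‖q - 1‖
        ≤ (B * MΓ / 2) * x * ℓ ^ (z.re - 1) * 4 * (2 * (R + 1) * (h / ℓ)) := by gcongr
      _ = 8 * (R + 1) * (B * MΓ / 2) * x * (ℓ ^ (z.re - 1) / ℓ) * h := by ring
      _ = 8 * (R + 1) * (B * MΓ / 2) * x * ℓ ^ (z.re - 2) * h := by
          rw [show z.re - 2 = (z.re - 1) - 1 by ring, Real.rpow_sub_one hℓ0.ne' (z.re - 1)]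
      _ ≤ 8 * (R + 1) * (B * MΓ / 2) * x * ℓ ^ (z.re - 2) * 1 := by gcongr
      _ = _ := mul_one _
  calc ‖((S₁ - A * (y₁ : ℂ) ^ 2 * (ℓ₁ : ℂ) ^ (z - 1)) - (S₀ - A * (x : ℂ) ^ 2 * (ℓ : ℂ) ^ (z - 1))) /
        (((h * x : ℝ)) : ℂ) + A * x * (ℓ : ℂ) ^ (z - 1) * (1 + h) ^ 2 * (q - 1) / h‖
      ≤ C * (4 * 2 ^ (R + 2) + 1) * x * ℓ ^ (z.re - 2) / h + 8 * (R + 1) * (B * MΓ / 2) * x * ℓ ^ (z.re - 2) / h :=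
        (norm_add_le _ _).trans (add_le_add hfirst hsecond)
    _ = (8 * (R + 1) * (B * MΓ / 2) + C * (4 * 2 ^ (R + 2) + 1)) * x * ℓ ^ (z.re - 2) / h := by ring


/-! ### Cauchy's coefficient formula for the polynomial `W_z` -/

/-- `∮_{|z|=s} z^j z^{−(k+1)} dz = 2πi [j = k]`: the `zpow` form (used under `rw` below) of the
tree's `circleIntegral_pow_div_pow_succ` (`SatheSelbergProofs`, in the import closure), of which it
is a one-line restatement (dedup-01126, 2026-08-16). [folklore] -/
theorem circleIntegral_pow_mul_zpow {s : ℝ} (hs : 0 < s) (j k : ℕ) :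
    ∮ z in C(0, s), z ^ j * z ^ (-(k + 1 : ℤ)) = if j = k then 2 * π * I else 0 :=
  circleIntegral_pow_div_pow_succ j k hs

/-- Circle integrals of finite sums of continuous functions. [folklore] -/
theorem circleIntegral_finset_sum {ι : Type*} (S : Finset ι) {f : ι → ℂ → ℂ} {c : ℂ} {R : ℝ}
    (hf : ∀ i ∈ S, ContinuousOn (f i) (sphere c |R|)) :
    ∮ z in C(c, R), ∑ i ∈ S, f i z = ∑ i ∈ S, ∮ z in C(c, R), f i z := by
  simp only [circleIntegral, Finset.smul_sum]
  rw [intervalIntegral.integral_finsetSum]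
  intro i hi
  exact (circleIntegrable_iff R).1 ((hf i hi).circleIntegrable')

/-- **Coefficient extraction**: for a finite sum `P(z) = ∑_{n ∈ S} c_n z^{ω(n)}`,
`∮_{|z|=s} P(z) z^{−(k+1)} dz = 2πi ∑_{n ∈ S, ω(n) = k} c_n` (MV (7.61)). [cite: MontgomeryVaughan2007, §7.4 (7.61)] -/
theorem circleIntegral_omegaSum {s : ℝ} (hs : 0 < s) (S : Finset ℕ) (c : ℕ → ℂ) (k : ℕ) :
    ∮ z in C(0, s), (∑ n ∈ S, omegaCoeff z n * c n) * z ^ (-(k + 1 : ℤ)) =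
      2 * π * I * ∑ n ∈ S.filter (fun n ↦ ω n = k), c n := by
  have e : (fun z : ℂ ↦ (∑ n ∈ S, omegaCoeff z n * c n) * z ^ (-(k + 1 : ℤ))) =
      fun z ↦ ∑ n ∈ S, c n * (z ^ (ω n) * z ^ (-(k + 1 : ℤ))) := by
    funext z; rw [Finset.sum_mul]; refine Finset.sum_congr rfl fun n _ ↦ ?_
    simp only [omegaCoeff]; ring
  rw [e, circleIntegral_finset_sum]
  · rw [Finset.sum_filter, Finset.mul_sum]
    refine Finset.sum_congr rfl fun n _ ↦ ?_
    rw [circleIntegral.integral_const_mul, circleIntegral_pow_mul_zpow hs]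
    split_ifs <;> ring
  · intro n _
    refine ContinuousOn.mul continuousOn_const (ContinuousOn.mul (continuous_pow _).continuousOn ?_)
    refine ContinuousOn.zpow₀ continuousOn_id _ fun z hz ↦ Or.inl ?_
    rw [abs_of_pos hs] at hz
    exact ne_zero_of_mem_sphere_zero hs hz

/-! ### The exponential integrals of the main term -/

/-- `∮_{|z|=s} e^{Lz} z^{−(n+1)} dz = 2πi Lⁿ/n!` (Cauchy's formula for the `n`-th derivative of `e^{Lz}`).
[cite: MontgomeryVaughan2007, §7.4 p. 180 ("the first integral is (log log x)^{k−1}/(k−1)! by Cauchy's theorem")] -/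
theorem circleIntegral_exp_mul_zpow {s : ℝ} (hs : 0 < s) (L : ℂ) (n : ℕ) :
    ∮ z in C(0, s), exp (L * z) * z ^ (-(n + 1 : ℤ)) = 2 * π * I * L ^ n / n.factorial := by
  have hdiff : DiffContOnCl ℂ (fun z : ℂ ↦ exp (L * z)) (ball (0 : ℂ) s) :=
    (Differentiable.diffContOnCl (by fun_prop))
  have h := hdiff.circleIntegral_one_div_sub_center_pow_smul hs n
  simp only [sub_zero, smul_eq_mul, one_div] at h
  rw [iteratedDeriv_cexp_const_mul] at h
  simp only [mul_zero, exp_zero, mul_one] at h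
  have e : (fun z : ℂ ↦ exp (L * z) * z ^ (-(n + 1 : ℤ))) = fun z : ℂ ↦ (z ^ (n + 1))⁻¹ * exp (L * z) := by
    funext z
    rw [show (-(n + 1 : ℤ)) = -((n + 1 : ℕ) : ℤ) by push_cast; ring, zpow_neg, zpow_natCast]; ring
  rw [e, h]
  field_simp

/-- `∮_{|z|=s} e^{Lz} dz = 0`. [folklore] -/
theorem circleIntegral_exp_mul {s : ℝ} (hs : 0 < s) (L : ℂ) :
    ∮ z in C(0, s), exp (L * z) = 0 :=
  Complex.circleIntegral_eq_zero_of_differentiable_on_off_countable hs.le Set.countable_empty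
    (by fun_prop) fun z _ ↦ by fun_prop

/-- **The linear term vanishes at the saddle point**: with `r = m/L` (`= (k−1)/log log x`,
`k = m + 1`), `∮_{|z|=s} (z − r) e^{Lz} z^{−(m+1)} dz = 0` (`L > 0`); this is MV's identity
`r ∮ (log x)^z z^{−k} dz = ∮ (log x)^z z^{1−k} dz`. [cite: MontgomeryVaughan2007, §7.4 p. 180] -/
theorem circleIntegral_linear_term_eq_zero {s L : ℝ} (hs : 0 < s) (hL : 0 < L) (m : ℕ) :
    ∮ z in C(0, s), (z - ((m : ℝ) / L : ℝ)) * exp (L * z) * z ^ (-(m + 1 : ℤ)) = 0 := by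
  have hLc : (L : ℂ) ≠ 0 := ofReal_ne_zero.2 hL.ne'
  -- on the circle `(z − r) z^{-(m+1)} = z^{-m} − r z^{-(m+1)}`
  have key : EqOn (fun z : ℂ ↦ (z - ((m : ℝ) / L : ℝ)) * exp (L * z) * z ^ (-(m + 1 : ℤ)))
      (fun z : ℂ ↦ exp (L * z) * z ^ (-(m : ℤ)) - (((m : ℝ) / L : ℝ) : ℂ) * (exp (L * z) * z ^ (-(m + 1 : ℤ))))
      (sphere (0 : ℂ) s) := by
    intro z hz
    have hz0 : z ≠ 0 := ne_zero_of_mem_sphere_zero hs hz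
    have e1 : z * z ^ (-(m + 1 : ℤ)) = z ^ (-(m : ℤ)) := by
      rw [show (-(m + 1 : ℤ)) = -(m : ℤ) - 1 by ring, zpow_sub₀ hz0, zpow_one]
      field_simp
    simp only
    rw [sub_mul, sub_mul]
    congr 1
    · rw [← e1]; ring
    · ring
  have hcont : ∀ n : ℤ, ContinuousOn (fun z : ℂ ↦ exp (L * z) * z ^ n) (sphere (0 : ℂ) s) := fun n ↦
    ContinuousOn.mul (by fun_prop) (ContinuousOn.zpow₀ continuousOn_id _ fun z hz ↦
      Or.inl (ne_zero_of_mem_sphere_zero hs hz))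
  have hint1 : CircleIntegrable (fun z : ℂ ↦ exp (L * z) * z ^ (-(m : ℤ))) 0 s :=
    ContinuousOn.circleIntegrable hs.le (hcont _)
  have hint2 : CircleIntegrable (fun z : ℂ ↦ (((m : ℝ) / L : ℝ) : ℂ) * (exp (L * z) * z ^ (-(m + 1 : ℤ)))) 0 s :=
    ContinuousOn.circleIntegrable hs.le (continuousOn_const.mul (hcont _))
  rw [circleIntegral.integral_congr hs.le key, circleIntegral.integral_sub hint1 hint2,
    circleIntegral.integral_const_mul, circleIntegral_exp_mul_zpow hs (L : ℂ) m]
  rcases Nat.eq_zero_or_pos m with rfl | hm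
  · -- `k = 1`: `r = 0` and `∮ e^{Lz} = 0`
    simp only [Nat.cast_zero, zero_div, ofReal_zero, zero_mul, sub_zero, neg_zero,
      zpow_zero, mul_one]
    exact circleIntegral_exp_mul hs (L : ℂ)
  · obtain ⟨m', rfl⟩ : ∃ m', m = m' + 1 := ⟨m - 1, by omega⟩
    rw [show (-((m' + 1 : ℕ) : ℤ)) = -(m' + 1 : ℤ) by push_cast; ring,
      circleIntegral_exp_mul_zpow hs (L : ℂ) m', Nat.factorial_succ]
    push_cast
    field_simp
    ring

/-! ### The calculus lemma `∫ (1 − cos θ) e^{m cos θ} dθ ≪ e^m m^{−3/2}` -/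

/-- `v e^{−v/2} ≤ 2/e ≤ 1` for `v ≥ 0`, in the form `v e^{−v} ≤ e^{−v/2}`. [folklore] -/
theorem mul_exp_neg_le (v : ℝ) : v * Real.exp (-v) ≤ Real.exp (-(v / 2)) := by
  have h1 : v / 2 ≤ Real.exp (v / 2 - 1) := by
    have := Real.add_one_le_exp (v / 2 - 1); linarith
  have h2 : Real.exp (v / 2 - 1) ≤ Real.exp (v / 2) / 2 := by
    rw [Real.exp_sub, div_le_div_iff₀ (Real.exp_pos 1) two_pos]
    have : (2 : ℝ) ≤ Real.exp 1 := by
      have := Real.add_one_le_exp (1 : ℝ); linarith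
    nlinarith [Real.exp_pos (v / 2)]
  have h3 : v ≤ Real.exp (v / 2) := by linarith
  have e : Real.exp (-(v / 2)) = Real.exp (v / 2) * Real.exp (-v) := by
    rw [← Real.exp_add]; congr 1; ring
  rw [e]
  exact mul_le_mul_of_nonneg_right h3 (Real.exp_pos _).le

/-- **`∫₀^{2π} (1 − cos θ) e^{m cos θ} dθ ≤ C₀ e^{m} m^{−3/2}`** for `m > 0` (MV: "`|sin x| ≤ |x|` and
`cos 2πθ ≤ 1 − 8θ²` … `≪ e^{k−1}(k−1)^{−3/2}`"). [cite: MontgomeryVaughan2007, §7.4 p. 180] -/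
theorem integral_one_sub_cos_mul_exp_le {m : ℝ} (hm : 0 < m) :
    ∫ θ in (0 : ℝ)..2 * π, (1 - Real.cos θ) * Real.exp (m * Real.cos θ) ≤
      (π ^ 2 * Real.sqrt (π ^ 3) / 2) * Real.exp m / (m * Real.sqrt m) := by
  set a : ℝ := 2 * m / π ^ 2 with ha
  have hπ := Real.pi_pos
  have ha0 : 0 < a := by positivity
  -- shift to `[−π, π]` by periodicity
  have hper : Function.Periodic (fun θ : ℝ ↦ (1 - Real.cos θ) * Real.exp (m * Real.cos θ)) (2 * π) := by
    intro θ; simp [Real.cos_add_two_pi]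
  have hshift := hper.intervalIntegral_add_eq 0 (-π)
  rw [zero_add, show -π + 2 * π = π by ring] at hshift
  rw [hshift]
  -- pointwise bound on `[−π, π]`
  have hpt : ∀ θ ∈ Set.Icc (-π) π, (1 - Real.cos θ) * Real.exp (m * Real.cos θ) ≤
      (1 / a) * Real.exp m * Real.exp (-(a / 2) * θ ^ 2) := by
    intro θ hθ
    have hθπ : |θ| ≤ π := abs_le.2 ⟨hθ.1, hθ.2⟩
    have h1 : 1 - Real.cos θ ≤ θ ^ 2 / 2 := by linarith [Real.one_sub_sq_div_two_le_cos (x := θ)]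
    have h1' : 0 ≤ 1 - Real.cos θ := by linarith [Real.cos_le_one θ]
    have h2 : Real.cos θ ≤ 1 - 2 / π ^ 2 * θ ^ 2 := Real.cos_le_one_sub_mul_cos_sq hθπ
    have h3 : Real.exp (m * Real.cos θ) ≤ Real.exp m * Real.exp (-(a * θ ^ 2)) := by
      rw [← Real.exp_add, Real.exp_le_exp, ha]
      have := mul_le_mul_of_nonneg_left h2 hm.le
      have e : m * (1 - 2 / π ^ 2 * θ ^ 2) = m + -(2 * m / π ^ 2 * θ ^ 2) := by ring
      linarith
    have hv := mul_exp_neg_le (a * θ ^ 2)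
    calc (1 - Real.cos θ) * Real.exp (m * Real.cos θ)
        ≤ (θ ^ 2 / 2) * (Real.exp m * Real.exp (-(a * θ ^ 2))) :=
          mul_le_mul h1 h3 (Real.exp_pos _).le (by positivity)
      _ = (1 / (2 * a)) * Real.exp m * ((a * θ ^ 2) * Real.exp (-(a * θ ^ 2))) := by
          field_simp
      _ ≤ (1 / (2 * a)) * Real.exp m * Real.exp (-(a * θ ^ 2 / 2)) := by gcongr
      _ ≤ (1 / a) * Real.exp m * Real.exp (-(a / 2) * θ ^ 2) := by
          rw [show -(a * θ ^ 2 / 2) = -(a / 2) * θ ^ 2 by ring]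
          have : 1 / (2 * a) ≤ 1 / a := div_le_div_of_nonneg_left zero_le_one ha0 (by linarith)
          gcongr
  -- integrate the Gaussian majorant over `(0, ∞)` twice (even function: use `[−π, π] ⊆ ℝ`)
  have hgi : Integrable (fun θ : ℝ ↦ (1 / a) * Real.exp m * Real.exp (-(a / 2) * θ ^ 2)) :=
    (integrable_exp_neg_mul_sq (by positivity : 0 < a / 2)).const_mul _
  have hgauss : ∫ θ : ℝ, Real.exp (-(a / 2) * θ ^ 2) = Real.sqrt (π / (a / 2)) := integral_gaussian (a / 2)
  calc ∫ θ in (-π)..π, (1 - Real.cos θ) * Real.exp (m * Real.cos θ)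
      ≤ ∫ θ in (-π)..π, (1 / a) * Real.exp m * Real.exp (-(a / 2) * θ ^ 2) := by
        refine intervalIntegral.integral_mono_on (by linarith) ?_ (hgi.intervalIntegrable) fun θ hθ ↦ hpt θ hθ
        exact (Continuous.intervalIntegrable (by fun_prop) _ _)
    _ ≤ ∫ θ : ℝ, (1 / a) * Real.exp m * Real.exp (-(a / 2) * θ ^ 2) := by
        rw [intervalIntegral.integral_of_le (by linarith)]
        exact setIntegral_le_integral hgi (Eventually.of_forall fun θ ↦ by positivity)
    _ = (1 / a) * Real.exp m * Real.sqrt (π / (a / 2)) := by rw [MeasureTheory.integral_const_mul, hgauss]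
    _ = (π ^ 2 * Real.sqrt (π ^ 3) / 2) * Real.exp m / (m * Real.sqrt m) := by
        have e1 : π / (a / 2) = π ^ 3 / m := by rw [ha]; field_simp
        rw [e1, Real.sqrt_div (by positivity) m, ha]
        have hsm : 0 < Real.sqrt m := Real.sqrt_pos.2 hm
        field_simp


/-! ### The function `G(z) = F(1,z)/Γ(z+1)` -/

/-- `G(z) = F(1,z)/Γ(z+1)` is entire. [cite: MontgomeryVaughan2007, §7.4 p. 180] -/
theorem differentiable_G :
    Differentiable ℂ (fun z : ℂ ↦ selbergF 1 z * (Complex.Gamma (z + 1))⁻¹) := by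
  have h1 : Differentiable ℂ (fun z : ℂ ↦ (Complex.Gamma (z + 1))⁻¹) :=
    Complex.differentiable_one_div_Gamma.comp (differentiable_id.add_const 1)
  exact (differentiable_selbergF_param (by norm_num)).mul h1

/-- `F(1,z)/Γ(z) = z G(z)`. [cite: MontgomeryVaughan2007, §7.4 p. 180] -/
theorem selbergF_div_Gamma_eq (z : ℂ) :
    selbergF 1 z / Complex.Gamma z = z * (selbergF 1 z * (Complex.Gamma (z + 1))⁻¹) := by
  rw [div_eq_mul_inv, Complex.one_div_Gamma_eq_self_mul_one_div_Gamma_add_one z]; ring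

/-- `G` is bounded on discs. [folklore] -/
theorem exists_bound_G (T : ℝ) :
    ∃ M : ℝ, 0 ≤ M ∧ ∀ z : ℂ, ‖z‖ ≤ T → ‖selbergF 1 z * (Complex.Gamma (z + 1))⁻¹‖ ≤ M := by
  obtain ⟨M, hM⟩ := (isCompact_closedBall (0 : ℂ) T).exists_bound_of_continuousOn
    differentiable_G.continuous.continuousOn
  exact ⟨max M 0, le_max_right _ _, fun z hz ↦ (hM z (by simpa using hz)).trans (le_max_left _ _)⟩

/-- `G(r) = Re F(1,r)/Γ(r+1)` is real for real `r`. [folklore] -/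
theorem G_ofReal (r : ℝ) :
    selbergF 1 r * (Complex.Gamma ((r : ℂ) + 1))⁻¹ =
      (((selbergF 1 r).re / Real.Gamma (r + 1) : ℝ) : ℂ) := by
  have h1 : Complex.Gamma ((r : ℂ) + 1) = ((Real.Gamma (r + 1) : ℝ) : ℂ) := by
    rw [← Complex.Gamma_ofReal]; push_cast; rfl
  rw [h1]
  conv_lhs => rw [selbergF_one_ofReal_eq r]
  push_cast
  ring

/-- `G(r) ≥ g > 0` for `0 ≤ r ≤ R`. [folklore] -/
theorem exists_G_lower {R : ℝ} (hR : 0 ≤ R) :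
    ∃ g : ℝ, 0 < g ∧ ∀ r : ℝ, 0 ≤ r → r ≤ R → g ≤ (selbergF 1 r).re / Real.Gamma (r + 1) := by
  obtain ⟨m, hm, hmF⟩ := exists_pos_le_selbergF_one_re hR
  have hc : ContinuousOn Real.Gamma (Set.Icc 1 (R + 1)) := by
    intro s hs
    refine (Real.differentiableAt_Gamma fun n h ↦ ?_).continuousAt.continuousWithinAt
    have h0 : (0 : ℝ) ≤ n := n.cast_nonneg
    rw [h] at hs
    linarith [hs.1]
  obtain ⟨Γm, hΓm⟩ := (isCompact_Icc (a := (1 : ℝ)) (b := R + 1)).exists_bound_of_continuousOn hc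
  have hΓm1 : 1 ≤ Γm := by
    have := hΓm 1 ⟨le_rfl, by linarith⟩
    rwa [Real.Gamma_one, Real.norm_eq_abs, abs_one] at this
  have hΓm0 : 0 < Γm := by linarith
  refine ⟨m / Γm, div_pos hm hΓm0, fun r hr0 hrR ↦ ?_⟩
  have hΓpos : 0 < Real.Gamma (r + 1) := Real.Gamma_pos_of_pos (by linarith)
  have hΓle : Real.Gamma (r + 1) ≤ Γm := by
    have := hΓm (r + 1) ⟨by linarith, by linarith⟩
    rwa [Real.norm_eq_abs, abs_of_pos hΓpos] at this
  rw [div_le_div_iff₀ hΓm0 hΓpos]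
  calc m * Real.Gamma (r + 1) ≤ m * Γm := by gcongr
    _ ≤ (selbergF 1 r).re * Γm := by gcongr; exact hmF r hr0 hrR

/-- `G` is Lipschitz on `[0, R]`. [folklore] -/
theorem exists_G_lipschitz {R : ℝ} (hR : 0 ≤ R) :
    ∃ Λ : ℝ, 0 ≤ Λ ∧ ∀ r r' : ℝ, 0 ≤ r → r ≤ R → 0 ≤ r' → r' ≤ R →
      |(selbergF 1 r').re / Real.Gamma (r' + 1) - (selbergF 1 r).re / Real.Gamma (r + 1)| ≤
        Λ * |r' - r| := by
  obtain ⟨M, hM0, hM⟩ := exists_bound_G (3 * R + 2)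
  have hρ : 0 < 2 * R + 2 := by linarith
  refine ⟨4 * M / (2 * R + 2), by positivity, fun r r' hr hrR hr' hr'R ↦ ?_⟩
  have key := norm_sub_le_of_bound_on_ball
    (f := fun z : ℂ ↦ selbergF 1 z * (Complex.Gamma (z + 1))⁻¹) (c := (r : ℂ)) (M := M) hρ
    differentiable_G.differentiableOn ?_ (s := (r' : ℂ)) ?_
  · simp only [G_ofReal] at key
    rwa [← ofReal_sub, ← ofReal_sub, Complex.norm_real, Complex.norm_real, Real.norm_eq_abs,
      Real.norm_eq_abs] at key
  · intro w hw
    apply hM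
    rw [mem_ball, dist_eq_norm] at hw
    calc ‖w‖ = ‖(w - r) + r‖ := by rw [sub_add_cancel]
      _ ≤ ‖w - r‖ + ‖(r : ℂ)‖ := norm_add_le _ _
      _ ≤ (2 * R + 2) + R := by
          rw [Complex.norm_real, Real.norm_eq_abs, abs_of_nonneg hr]; linarith
      _ = 3 * R + 2 := by ring
  · rw [← ofReal_sub, Complex.norm_real, Real.norm_eq_abs, abs_le]; constructor <;> linarith

/-! ### The remainder integral (MV's second-order Taylor decomposition of `G` at `r`) -/

/-- `‖s e^{iθ} − s‖² = 2 s² (1 − cos θ)`. [folklore] -/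
theorem norm_circleMap_sub_sq (s θ : ℝ) :
    ‖circleMap 0 s θ - (s : ℂ)‖ ^ 2 = 2 * s ^ 2 * (1 - Real.cos θ) := by
  rw [circleMap_zero, Complex.sq_norm, Complex.normSq_apply]
  simp only [sub_re, sub_im, mul_re, mul_im, ofReal_re, ofReal_im, exp_ofReal_mul_I_re,
    exp_ofReal_mul_I_im, zero_mul, sub_zero, add_zero]
  linear_combination s ^ 2 * Real.sin_sq_add_cos_sq θ

/-- Second-order Taylor remainder from a sup bound on a disc (Cauchy's estimate):
`‖f(z) − f(c) − (z − c) f'(c)‖ ≤ (4M/ρ²) ‖z − c‖²`. [folklore] -/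
theorem norm_taylor_remainder_le {f : ℂ → ℂ} (hf : Differentiable ℂ f) {c z : ℂ} {ρ M : ℝ}
    (hM : ∀ w ∈ ball c ρ, ‖f w‖ ≤ M) (hz : ‖z - c‖ < ρ) :
    ‖f z - f c - (z - c) * deriv f c‖ ≤ 4 * M / ρ ^ 2 * ‖z - c‖ ^ 2 := by
  have h := Literature.Analysis.Complex.norm_sub_sub_fderiv_le_of_forall_mem_ball_norm_le
    hf.differentiableOn hM (by rwa [mem_ball, dist_eq_norm])
  have e : (fderiv ℂ f c) (z - c) = (z - c) * deriv f c := by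
    have h1 := (fderiv ℂ f c).map_smul (z - c) (1 : ℂ)
    rw [smul_eq_mul, smul_eq_mul, mul_one, fderiv_apply_one_eq_deriv] at h1
    exact h1
  rw [e] at h
  have hρ : ρ ≠ 0 := (lt_of_le_of_lt (norm_nonneg _) hz).ne'
  calc _ ≤ 4 * M * (‖z - c‖ / ρ) ^ 2 := h
    _ = 4 * M / ρ ^ 2 * ‖z - c‖ ^ 2 := by field_simp

/-- `‖(2πi)⁻¹‖ = 1/(2π)`. [folklore] -/
theorem norm_inv_two_pi_I : ‖(2 * π * I : ℂ)⁻¹‖ = (2 * π)⁻¹ := by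
  rw [norm_inv, norm_mul, norm_mul, Complex.norm_I, mul_one, Complex.norm_real, Real.norm_eq_abs,
    abs_of_pos Real.pi_pos, Complex.norm_two]

/-- Stirling-type arithmetic for the remainder integral: for `m ≥ 1`, `s = m/L₂`,
`s³ s^{−(m+1)} e^m/(m√m) ≤ e (m+1) L₂^m/(L₂² m!)`. [folklore] -/
theorem remainder_arith {m : ℕ} (hm : 1 ≤ m) {L₂ : ℝ} (hL₂ : 0 < L₂) :
    ((m : ℝ) / L₂) ^ 3 * (((m : ℝ) / L₂) ^ (m + 1))⁻¹ * (Real.exp m / (m * Real.sqrt m)) ≤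
      Real.exp 1 * ((m + 1) * L₂ ^ m / (L₂ ^ 2 * m.factorial)) := by
  have hm0 : (0 : ℝ) < m := by exact_mod_cast hm
  have hm0' : (m : ℝ) ≠ 0 := hm0.ne'
  have hL₂' : L₂ ≠ 0 := hL₂.ne'
  have hq : 0 < Real.sqrt m := Real.sqrt_pos.2 hm0
  have hq' : Real.sqrt m ≠ 0 := hq.ne'
  have hfac : (0 : ℝ) < m.factorial := by exact_mod_cast m.factorial_pos
  have hst := factorial_mul_exp_le hm
  -- rewrite the left side as `L₂^(m+1)/L₂^3 · (e^m/(m^m √m)) · m`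
  have e1 : ((m : ℝ) / L₂) ^ 3 * (((m : ℝ) / L₂) ^ (m + 1))⁻¹ * (Real.exp m / (m * Real.sqrt m)) =
      L₂ ^ (m + 1) / L₂ ^ 3 * (Real.exp m / ((m : ℝ) ^ m * Real.sqrt m)) * m := by
    rw [div_pow, div_pow, inv_div]
    field_simp
    ring
  rw [e1]
  have h2 : Real.exp m / ((m : ℝ) ^ m * Real.sqrt m) ≤ Real.exp 1 / m.factorial := by
    rw [div_le_div_iff₀ (by positivity) hfac]
    calc Real.exp m * m.factorial = m.factorial * Real.exp m := by ring
      _ ≤ Real.exp 1 * Real.sqrt m * (m : ℝ) ^ m := hst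
      _ = Real.exp 1 * ((m : ℝ) ^ m * Real.sqrt m) := by ring
  have hL3 : L₂ ^ (m + 1) / L₂ ^ 3 = L₂ ^ m / L₂ ^ 2 := by
    rw [div_eq_div_iff (by positivity) (by positivity)]; ring
  calc L₂ ^ (m + 1) / L₂ ^ 3 * (Real.exp m / ((m : ℝ) ^ m * Real.sqrt m)) * m
      ≤ L₂ ^ (m + 1) / L₂ ^ 3 * (Real.exp 1 / m.factorial) * (m + 1) := by gcongr; linarith
    _ = Real.exp 1 * ((m + 1) * L₂ ^ m / (L₂ ^ 2 * m.factorial)) := by rw [hL3]; field_simp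

/-- **The remainder integral** (MV p. 180): for an entire `f` bounded by `M` on `‖w‖ ≤ 3T + 3`,
`L₂ ≥ 1`, `m ≤ T L₂`, `r = m/L₂`, `s = max(m,1)/L₂`,
`‖(2πi)⁻¹ ∮_{|z|=s} (f(z) − f(r) − f'(r)(z − r)) e^{L₂ z} z^{−(m+1)} dz‖ ≤ C (m+1) L₂^m/(L₂² m!)`
("`G(z) − G(r) − G'(r)(z − r) ≪ |z − r|²` … `≪ r^{3−k} ∫ sin²(θ/2) e^{(k−1)cos θ} dθ ≪ k (log log x)^{k−3}/(k−1)!`").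
[cite: MontgomeryVaughan2007, §7.4 p. 180] -/
theorem exists_remainder_integral_le {f : ℂ → ℂ} (hf : Differentiable ℂ f) {T M : ℝ} (hT : 0 ≤ T)
    (hM : ∀ w : ℂ, ‖w‖ ≤ 3 * T + 3 → ‖f w‖ ≤ M) :
    ∃ C : ℝ, 0 ≤ C ∧ ∀ L₂ : ℝ, 1 ≤ L₂ → ∀ m : ℕ, (m : ℝ) ≤ T * L₂ →
      ‖(2 * π * I)⁻¹ * ∮ z in C(0, max (m : ℝ) 1 / L₂),
          (f z - f ((m : ℝ) / L₂ : ℝ) - (z - ((m : ℝ) / L₂ : ℝ)) * deriv f ((m : ℝ) / L₂ : ℝ)) *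
            exp (L₂ * z) * z ^ (-(m + 1 : ℤ))‖ ≤
        C * ((m + 1) * L₂ ^ m / (L₂ ^ 2 * m.factorial)) := by
  have hM0 : 0 ≤ M := (norm_nonneg _).trans (hM 0 (by simp; positivity))
  set ρ : ℝ := 2 * T + 3 with hρ
  have hρ0 : 0 < ρ := by positivity
  set K : ℝ := 4 * M / ρ ^ 2 with hK
  have hK0 : 0 ≤ K := by positivity
  set C₀ : ℝ := π ^ 2 * Real.sqrt (π ^ 3) / 2 with hC₀
  have hC₀0 : 0 ≤ C₀ := by positivity
  -- Taylor remainder about real points `c ∈ [0, T]`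
  have hrem : ∀ c : ℝ, 0 ≤ c → c ≤ T → ∀ z : ℂ, ‖z - c‖ < ρ →
      ‖f z - f c - (z - c) * deriv f c‖ ≤ K * ‖z - c‖ ^ 2 := by
    intro c hc0 hcT z hz
    refine norm_taylor_remainder_le hf (fun w hw ↦ hM w ?_) hz
    rw [mem_ball, dist_eq_norm] at hw
    calc ‖w‖ = ‖(w - c) + c‖ := by rw [sub_add_cancel]
      _ ≤ ‖w - c‖ + ‖(c : ℂ)‖ := norm_add_le _ _
      _ ≤ ρ + T := by
          rw [Complex.norm_real, Real.norm_eq_abs, abs_of_nonneg hc0]; linarith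
      _ = 3 * T + 3 := by rw [hρ]; ring
  refine ⟨K * Real.exp 1 * (1 + C₀), by positivity, fun L₂ hL₂ m hm ↦ ?_⟩
  have hL₂0 : 0 < L₂ := by linarith
  rcases Nat.eq_zero_or_pos m with rfl | hmpos
  · -- `k = 1`: radius `1/L₂`, centre `0`
    have hs : (0 : ℝ) < max ((0 : ℕ) : ℝ) 1 / L₂ := by positivity
    have hs1 : max ((0 : ℕ) : ℝ) 1 / L₂ = 1 / L₂ := by simp
    simp only [Nat.cast_zero, zero_div, ofReal_zero, sub_zero, zero_add, Nat.factorial_zero,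
      Nat.cast_one, mul_one, pow_zero]
    rw [show max (0 : ℝ) 1 = 1 by simp]
    have hs' : (0 : ℝ) < 1 / L₂ := by positivity
    have hpt : ∀ z ∈ sphere (0 : ℂ) (1 / L₂),
        ‖(f z - f 0 - z * deriv f 0) * exp (L₂ * z) * z ^ (-(1 : ℤ))‖ ≤
          K * (1 / L₂) ^ 2 * Real.exp 1 * (1 / L₂)⁻¹ := by
      intro z hz
      have hzs : ‖z‖ = 1 / L₂ := by simpa using hz
      have h1 : ‖f z - f 0 - z * deriv f 0‖ ≤ K * (1 / L₂) ^ 2 := by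
        have := hrem 0 le_rfl hT z (by
          rw [ofReal_zero, sub_zero, hzs]
          calc 1 / L₂ ≤ 1 := by rw [div_le_one hL₂0]; exact hL₂
            _ < ρ := by rw [hρ]; linarith)
        rw [ofReal_zero, sub_zero] at this
        rwa [hzs] at this
      have h2 : ‖exp (L₂ * z)‖ ≤ Real.exp 1 := by
        rw [Complex.norm_exp, Real.exp_le_exp, re_ofReal_mul]
        calc L₂ * z.re ≤ L₂ * ‖z‖ := by gcongr; exact re_le_norm z
          _ = 1 := by rw [hzs]; field_simp
      have h3 : ‖z ^ (-(1 : ℤ))‖ = (1 / L₂)⁻¹ := by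
        rw [norm_zpow, hzs, zpow_neg, zpow_one]
      rw [norm_mul, norm_mul, h3]
      exact mul_le_mul_of_nonneg_right (mul_le_mul h1 h2 (norm_nonneg _) (by positivity))
        (by positivity)
    have hint := circleIntegral.norm_integral_le_of_norm_le_const hs'.le hpt
    rw [norm_mul, norm_inv_two_pi_I]
    calc (2 * π)⁻¹ * ‖∮ z in C(0, 1 / L₂), (f z - f 0 - z * deriv f 0) * exp (L₂ * z) * z ^ (-(1 : ℤ))‖
        ≤ (2 * π)⁻¹ * (2 * π * (1 / L₂) * (K * (1 / L₂) ^ 2 * Real.exp 1 * (1 / L₂)⁻¹)) := by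
          gcongr
      _ = K * Real.exp 1 * 1 * (1 / L₂ ^ 2) := by field_simp
      _ ≤ K * Real.exp 1 * (1 + C₀) * (1 / L₂ ^ 2) := by gcongr; linarith
  · -- `k ≥ 2`: radius `r = m/L₂`, centre `r`
    have hm1 : (1 : ℝ) ≤ m := by exact_mod_cast hmpos
    have hmax : max (m : ℝ) 1 = m := max_eq_left hm1
    rw [hmax]
    set s : ℝ := (m : ℝ) / L₂ with hs
    have hs0 : 0 < s := by positivity
    have hsT : s ≤ T := by rw [hs, div_le_iff₀ hL₂0]; exact hm
    have hsL : L₂ * s = m := by rw [hs]; field_simp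
    have hmR : (0 : ℝ) < m := by linarith
    -- pointwise bound along the parametrisation
    have hpt : ∀ θ : ℝ, ‖deriv (circleMap 0 s) θ •
        ((fun z : ℂ ↦ (f z - f s - (z - s) * deriv f s) * exp (L₂ * z) * z ^ (-(m + 1 : ℤ)))
          (circleMap 0 s θ))‖ ≤
        2 * K * s ^ 3 * (s ^ (m + 1))⁻¹ * ((1 - Real.cos θ) * Real.exp (m * Real.cos θ)) := by
      intro θ
      have hzs : ‖circleMap 0 s θ‖ = s := by rw [norm_circleMap_zero, abs_of_pos hs0]
      have hz0 : circleMap 0 s θ ≠ 0 := by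
        intro h; rw [h, norm_zero] at hzs; exact hs0.ne' hzs.symm
      have h1 : ‖f (circleMap 0 s θ) - f s - (circleMap 0 s θ - s) * deriv f s‖ ≤
          K * (2 * s ^ 2 * (1 - Real.cos θ)) := by
        have := hrem s hs0.le hsT (circleMap 0 s θ) (by
          calc ‖circleMap 0 s θ - s‖ ≤ ‖circleMap 0 s θ‖ + ‖(s : ℂ)‖ := norm_sub_le _ _
            _ = 2 * s := by rw [hzs, Complex.norm_real, Real.norm_eq_abs, abs_of_pos hs0]; ring
            _ < ρ := by rw [hρ]; linarith)
        rwa [norm_circleMap_sub_sq] at this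
      have h2 : ‖exp (L₂ * circleMap 0 s θ)‖ = Real.exp (m * Real.cos θ) := by
        rw [Complex.norm_exp, re_ofReal_mul, circleMap_zero, mul_re, ofReal_re, ofReal_im,
          exp_ofReal_mul_I_re, zero_mul, sub_zero, ← mul_assoc, hsL]
      have h3 : ‖(circleMap 0 s θ) ^ (-(m + 1 : ℤ))‖ = (s ^ (m + 1))⁻¹ := by
        rw [norm_zpow, hzs, show (-(m + 1 : ℤ)) = -((m + 1 : ℕ) : ℤ) by push_cast; ring, zpow_neg,
          zpow_natCast]
      have h4 : ‖deriv (circleMap 0 s) θ‖ = s := by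
        rw [deriv_circleMap, norm_mul, hzs, Complex.norm_I, mul_one]
      rw [norm_smul, h4]
      simp only
      rw [norm_mul, norm_mul, h2, h3]
      have h1' := mul_le_mul_of_nonneg_right h1 (Real.exp_pos (m * Real.cos θ)).le
      calc s * (‖f (circleMap 0 s θ) - f s - (circleMap 0 s θ - s) * deriv f s‖ *
            Real.exp (m * Real.cos θ) * (s ^ (m + 1))⁻¹)
          ≤ s * (K * (2 * s ^ 2 * (1 - Real.cos θ)) * Real.exp (m * Real.cos θ) * (s ^ (m + 1))⁻¹) := by
            gcongr
        _ = _ := by ring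
    have hle : ‖∮ z in C(0, s), (f z - f s - (z - s) * deriv f s) * exp (L₂ * z) * z ^ (-(m + 1 : ℤ))‖ ≤
        ∫ θ in (0 : ℝ)..2 * π, 2 * K * s ^ 3 * (s ^ (m + 1))⁻¹ * ((1 - Real.cos θ) * Real.exp (m * Real.cos θ)) := by
      rw [circleIntegral]
      refine intervalIntegral.norm_integral_le_of_norm_le (by positivity)
        (Eventually.of_forall fun θ _ ↦ hpt θ) ?_
      exact (Continuous.intervalIntegrable (by fun_prop) _ _)
    rw [intervalIntegral.integral_const_mul] at hle
    have hcal := integral_one_sub_cos_mul_exp_le hmR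
    rw [norm_mul, norm_inv_two_pi_I]
    have hπ := Real.pi_pos
    calc (2 * π)⁻¹ * ‖∮ z in C(0, s), (f z - f s - (z - s) * deriv f s) * exp (L₂ * z) * z ^ (-(m + 1 : ℤ))‖
        ≤ (2 * π)⁻¹ * (2 * K * s ^ 3 * (s ^ (m + 1))⁻¹ * (C₀ * Real.exp m / (m * Real.sqrt m))) := by
          gcongr
          exact hle.trans (by gcongr)
      _ = K * C₀ / π * (s ^ 3 * (s ^ (m + 1))⁻¹ * (Real.exp m / (m * Real.sqrt m))) := by
          field_simp
      _ ≤ K * C₀ / π * (Real.exp 1 * ((m + 1) * L₂ ^ m / (L₂ ^ 2 * m.factorial))) :=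
          mul_le_mul_of_nonneg_left (remainder_arith hmpos hL₂0) (by positivity)
      _ = K * Real.exp 1 * (C₀ / π) * ((m + 1) * L₂ ^ m / (L₂ ^ 2 * m.factorial)) := by ring
      _ ≤ K * Real.exp 1 * (1 + C₀) * ((m + 1) * L₂ ^ m / (L₂ ^ 2 * m.factorial)) := by
          gcongr
          calc C₀ / π ≤ C₀ / 1 := by gcongr; linarith [Real.pi_gt_three]
            _ ≤ 1 + C₀ := by linarith

/-! ### Coefficient extraction with an approximate generating function -/

/-- If `‖P(z) − Φ(z)‖ ≤ ε` on `|z| = s` for the polynomial `P(z) = ∑_{n∈S} c_n z^{ω(n)}`, then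
`‖∑_{ω(n)=k} c_n − (2πi)⁻¹ ∮ Φ(z) z^{−(k+1)} dz‖ ≤ ε s^{−k}` (MV: "since `r ≍ 1`" … the contribution of
the error term). [cite: MontgomeryVaughan2007, §7.4 p. 180] -/
theorem norm_coeff_sub_integral_le {s : ℝ} (hs : 0 < s) (S : Finset ℕ) (c : ℕ → ℂ) (k : ℕ)
    {Φ : ℂ → ℂ} (hΦ : ContinuousOn Φ (sphere (0 : ℂ) s)) {ε : ℝ}
    (hε : ∀ z ∈ sphere (0 : ℂ) s, ‖(∑ n ∈ S, omegaCoeff z n * c n) - Φ z‖ ≤ ε) :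
    ‖(∑ n ∈ S.filter (fun n ↦ ω n = k), c n) -
        (2 * π * I)⁻¹ * ∮ z in C(0, s), Φ z * z ^ (-(k + 1 : ℤ))‖ ≤ ε * (s ^ k)⁻¹ := by
  have h1 := circleIntegral_omegaSum hs S c k
  have h2πI : (2 * π * I : ℂ) ≠ 0 := by simp [Real.pi_ne_zero, I_ne_zero]
  have e1 : (∑ n ∈ S.filter (fun n ↦ ω n = k), c n) =
      (2 * π * I)⁻¹ * ∮ z in C(0, s), (∑ n ∈ S, omegaCoeff z n * c n) * z ^ (-(k + 1 : ℤ)) := by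
    rw [h1, ← mul_assoc, inv_mul_cancel₀ h2πI, one_mul]
  have hzpow : ContinuousOn (fun z : ℂ ↦ z ^ (-(k + 1 : ℤ))) (sphere (0 : ℂ) s) :=
    ContinuousOn.zpow₀ continuousOn_id _ fun z hz ↦ Or.inl (ne_zero_of_mem_sphere_zero hs hz)
  have hP : ContinuousOn (fun z : ℂ ↦ (∑ n ∈ S, omegaCoeff z n * c n) * z ^ (-(k + 1 : ℤ)))
      (sphere (0 : ℂ) s) := by
    refine ContinuousOn.mul (continuousOn_finsetSum _ fun n _ ↦ ?_) hzpow
    change ContinuousOn (fun z : ℂ ↦ z ^ (ω n) * c n) _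
    fun_prop
  have hI2 : CircleIntegrable (fun z : ℂ ↦ Φ z * z ^ (-(k + 1 : ℤ))) 0 s :=
    (hΦ.mul hzpow).circleIntegrable hs.le
  rw [e1, ← mul_sub, ← circleIntegral.integral_sub (hP.circleIntegrable hs.le) hI2, norm_mul,
    norm_inv_two_pi_I]
  have hbound := circleIntegral.norm_integral_le_of_norm_le_const (c := 0) hs.le
    (f := fun z ↦ (∑ n ∈ S, omegaCoeff z n * c n) * z ^ (-(k + 1 : ℤ)) - Φ z * z ^ (-(k + 1 : ℤ)))
    (C := ε * (s ^ (k + 1))⁻¹) ?_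
  · have hπ := Real.pi_pos
    calc (2 * π)⁻¹ * ‖∮ z in C(0, s), ((∑ n ∈ S, omegaCoeff z n * c n) * z ^ (-(k + 1 : ℤ)) -
          Φ z * z ^ (-(k + 1 : ℤ)))‖ ≤ (2 * π)⁻¹ * (2 * π * s * (ε * (s ^ (k + 1))⁻¹)) := by gcongr
      _ = ε * (s ^ k)⁻¹ := by field_simp; ring
  · intro z hz
    have hzs : ‖z‖ = s := by simpa using hz
    rw [← sub_mul, norm_mul, norm_zpow, hzs,
      show (-(k + 1 : ℤ)) = -((k + 1 : ℕ) : ℤ) by push_cast; ring, zpow_neg, zpow_natCast]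
    gcongr
    exact hε z hz

/-- **The main-term integral** (MV p. 180): writing `f(z) = f(r) + f'(r)(z − r) + Rem(z)`,
`(2πi)⁻¹ ∮ A z f(z) e^{L₂ z} z^{−(m+2)} dz = A (f(r) L₂^m/m! + (2πi)⁻¹ ∮ Rem(z) e^{L₂z} z^{−(m+1)} dz)`,
the linear term vanishing for `r = m/L₂`. [cite: MontgomeryVaughan2007, §7.4 p. 180] -/
theorem mainTerm_integral_eq {f : ℂ → ℂ} (hf : Differentiable ℂ f) {s L₂ : ℝ} (hs : 0 < s)
    (hL : 0 < L₂) (A : ℂ) (m : ℕ) :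
    (2 * π * I)⁻¹ * ∮ z in C(0, s), (A * z * f z * exp (L₂ * z)) * z ^ (-(m + 1 + 1 : ℤ)) =
      A * (f ((m : ℝ) / L₂ : ℝ) * L₂ ^ m / m.factorial +
        (2 * π * I)⁻¹ * ∮ z in C(0, s),
          (f z - f ((m : ℝ) / L₂ : ℝ) - (z - ((m : ℝ) / L₂ : ℝ)) * deriv f ((m : ℝ) / L₂ : ℝ)) *
            exp (L₂ * z) * z ^ (-(m + 1 : ℤ))) := by
  set c : ℂ := (((m : ℝ) / L₂ : ℝ) : ℂ) with hc
  have h2πI : (2 * π * I : ℂ) ≠ 0 := by simp [Real.pi_ne_zero, I_ne_zero]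
  have hcont : ∀ n : ℤ, ContinuousOn (fun z : ℂ ↦ exp (L₂ * z) * z ^ n) (sphere (0 : ℂ) s) := fun n ↦
    ContinuousOn.mul (by fun_prop) (ContinuousOn.zpow₀ continuousOn_id _ fun z hz ↦
      Or.inl (ne_zero_of_mem_sphere_zero hs hz))
  have hfc : Continuous f := hf.continuous
  -- pointwise decomposition on the circle
  have key : EqOn (fun z : ℂ ↦ (A * z * f z * exp (L₂ * z)) * z ^ (-(m + 1 + 1 : ℤ)))
      (fun z : ℂ ↦ A * f c * (exp (L₂ * z) * z ^ (-(m + 1 : ℤ))) +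
        A * deriv f c * ((z - c) * exp (L₂ * z) * z ^ (-(m + 1 : ℤ))) +
        A * ((f z - f c - (z - c) * deriv f c) * exp (L₂ * z) * z ^ (-(m + 1 : ℤ))))
      (sphere (0 : ℂ) s) := by
    intro z hz
    have hz0 : z ≠ 0 := ne_zero_of_mem_sphere_zero hs hz
    have e1 : z * z ^ (-(m + 1 + 1 : ℤ)) = z ^ (-(m + 1 : ℤ)) := by
      rw [show (-(m + 1 + 1 : ℤ)) = -(m + 1 : ℤ) - 1 by ring, zpow_sub₀ hz0, zpow_one]
      field_simp
    simp only
    rw [← e1]; ring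
  have hi1 : CircleIntegrable (fun z : ℂ ↦ A * f c * (exp (L₂ * z) * z ^ (-(m + 1 : ℤ)))) 0 s :=
    (continuousOn_const.mul (hcont _)).circleIntegrable hs.le
  have hi2 : CircleIntegrable (fun z : ℂ ↦ A * deriv f c * ((z - c) * exp (L₂ * z) * z ^ (-(m + 1 : ℤ)))) 0 s := by
    refine (continuousOn_const.mul ?_).circleIntegrable hs.le
    have := hcont (-(m + 1 : ℤ))
    exact ((continuousOn_id.sub continuousOn_const).mul (by fun_prop)).mul
      (ContinuousOn.zpow₀ continuousOn_id _ fun z hz ↦ Or.inl (ne_zero_of_mem_sphere_zero hs hz))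
  have hi3 : CircleIntegrable (fun z : ℂ ↦ A * ((f z - f c - (z - c) * deriv f c) * exp (L₂ * z) *
      z ^ (-(m + 1 : ℤ)))) 0 s := by
    refine (continuousOn_const.mul ?_).circleIntegrable hs.le
    exact (((hfc.continuousOn.sub continuousOn_const).sub
      ((continuousOn_id.sub continuousOn_const).mul continuousOn_const)).mul (by fun_prop)).mul
      (ContinuousOn.zpow₀ continuousOn_id _ fun z hz ↦ Or.inl (ne_zero_of_mem_sphere_zero hs hz))
  have hi12 : CircleIntegrable (fun z : ℂ ↦ A * f c * (exp (L₂ * z) * z ^ (-(m + 1 : ℤ))) +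
      A * deriv f c * ((z - c) * exp (L₂ * z) * z ^ (-(m + 1 : ℤ)))) 0 s := hi1.add hi2
  have hlin : ∮ z in C(0, s), (z - c) * exp (L₂ * z) * z ^ (-(m + 1 : ℤ)) = 0 := by
    rw [hc]; exact circleIntegral_linear_term_eq_zero hs hL m
  rw [circleIntegral.integral_congr hs.le key, circleIntegral.integral_add hi12 hi3,
    circleIntegral.integral_add hi1 hi2, circleIntegral.integral_const_mul,
    circleIntegral.integral_const_mul, circleIntegral.integral_const_mul,
    circleIntegral_exp_mul_zpow hs (L₂ : ℂ) m, hlin, mul_zero, add_zero]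
  generalize (∮ z in C(0, s), (f z - f c - (z - c) * deriv f c) * exp (L₂ * z) * z ^ (-(m + 1 : ℤ))) = J
  have hfc0 : (m.factorial : ℂ) ≠ 0 := by exact_mod_cast m.factorial_ne_zero
  field_simp

/-- `(log X)^{z−1} = e^{z log log X}/log X` for `X > 1`. [folklore] -/
theorem log_cpow_eq {X : ℝ} (hX : 1 < X) (z : ℂ) :
    ((Real.log X : ℝ) : ℂ) ^ (z - 1) = exp ((Real.log (Real.log X) : ℝ) * z) / (Real.log X : ℝ) := by
  have hL : 0 < Real.log X := Real.log_pos hX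
  have hLc : ((Real.log X : ℝ) : ℂ) ≠ 0 := ofReal_ne_zero.2 hL.ne'
  rw [cpow_def_of_ne_zero hLc, ← ofReal_log hL.le, mul_sub, mul_one, exp_sub]
  congr 1
  rw [← ofReal_exp, Real.exp_log hL]

/-- Stirling-type arithmetic for the error term: `e^{max(m,1)} m! ≤ e (m+1) max(m,1)^{m+1}`. [folklore] -/
theorem errTerm_arith (m : ℕ) :
    Real.exp (max (m : ℝ) 1) * m.factorial ≤ Real.exp 1 * (m + 1) * (max (m : ℝ) 1) ^ (m + 1) := by
  rcases Nat.eq_zero_or_pos m with rfl | hm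
  · simp
  · have hm1 : (1 : ℝ) ≤ m := by exact_mod_cast hm
    rw [max_eq_left hm1]
    have hst := factorial_mul_exp_le hm
    have hsq : Real.sqrt m ≤ m + 1 := by
      rw [Real.sqrt_le_left (by positivity)]; nlinarith
    have hpow : (m : ℝ) ^ m ≤ (m : ℝ) ^ (m + 1) := pow_le_pow_right₀ hm1 (Nat.le_succ m)
    calc Real.exp m * m.factorial = m.factorial * Real.exp m := by ring
      _ ≤ Real.exp 1 * Real.sqrt m * (m : ℝ) ^ m := hst
      _ ≤ Real.exp 1 * (m + 1) * (m : ℝ) ^ (m + 1) := by gcongr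

/-- `L₂⁶ ≤ 720 e^{L₂}`. [folklore] -/
theorem pow_six_le_exp {L₂ : ℝ} (hL₂ : 0 ≤ L₂) : L₂ ^ 6 ≤ 720 * Real.exp L₂ := by
  have h := Real.pow_div_factorial_le_exp (x := L₂) hL₂ 6
  rw [show (Nat.factorial 6 : ℝ) = 720 by norm_num [Nat.factorial], div_le_iff₀ (by norm_num)] at h
  linarith


/-! ### `W_k(X, h) = M_k(X)(1 + O_R(k/(log log X)²))` (MV pp. 180–181) -/

set_option maxHeartbeats 1600000 in
/-- **The smoothed local law** (the heart of MV's proof of Theorem 7.19, here for `ω` and for the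
smoothed counts `W_k(X,h) = ∑_{ω(n) = k} φ(n)`): for `X ≥ x₀(R)`, `L₂ = log log X`,
`1/(2L₂³) ≤ h ≤ 2/L₂³` and `m ≤ R L₂`,
`|W_{m+1}(X, h) − M| ≤ C · M · (m+1)/L₂²`, `M = G(m/L₂) X L₂^m/(m! log X)`, `G(r) = F(1,r)/Γ(r+1)`.
[cite: MontgomeryVaughan2007, §7.4 pp. 180–181 and §7.4.1 Exercise 3(c)] -/
theorem shortCoeff_asymp (R : ℝ) (hR : 0 < R) :
    ∃ C : ℝ, 0 ≤ C ∧ ∃ x₀ : ℝ, 3 ≤ x₀ ∧ ∀ X : ℝ, x₀ ≤ X → ∀ h : ℝ,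
      1 / (2 * Real.log (Real.log X) ^ 3) ≤ h → h ≤ 2 / Real.log (Real.log X) ^ 3 →
      ∀ m : ℕ, (m : ℝ) ≤ R * Real.log (Real.log X) →
      |(∑ n ∈ (Finset.Ioc 0 ⌊X * (1 + h)⌋₊).filter (fun n ↦ ω n = m + 1),
          ((X * (1 + h) - n) - max (X - n) 0) / (h * X)) -
        (selbergF 1 ((m : ℝ) / Real.log (Real.log X) : ℝ)).re /
            Real.Gamma ((m : ℝ) / Real.log (Real.log X) + 1) *
          X * Real.log (Real.log X) ^ m / (m.factorial * Real.log X)| ≤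
      C * ((selbergF 1 ((m : ℝ) / Real.log (Real.log X) : ℝ)).re /
            Real.Gamma ((m : ℝ) / Real.log (Real.log X) + 1) *
          X * Real.log (Real.log X) ^ m / (m.factorial * Real.log X)) *
        ((m + 1) / Real.log (Real.log X) ^ 2) := by
  set G : ℂ → ℂ := fun w ↦ selbergF 1 w * (Complex.Gamma (w + 1))⁻¹ with hGdef
  have hGd : Differentiable ℂ G := differentiable_G
  obtain ⟨CW, hCW, x₀W, hx₀W, hW⟩ := shortMean_asymp (R + 1) (by linarith)
  obtain ⟨MG, hMG0, hMG⟩ := exists_bound_G (3 * R + 3)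
  obtain ⟨Crem, hCrem, hrem⟩ := exists_remainder_integral_le (f := G) (M := MG) hGd hR.le
    (fun w hw ↦ hMG w hw)
  obtain ⟨g, hg, hgle⟩ := exists_G_lower hR.le
  refine ⟨1 + 2 * Crem / g + 1440 * Real.exp 1 * CW / g, by positivity,
    max x₀W (Real.exp (Real.exp 2)), le_trans hx₀W (le_max_left _ _),
    fun X hX h hh1 hh2 m hm ↦ ?_⟩
  -- the parameters `L = log X`, `L₂ = log log X`
  have hXW : x₀W ≤ X := le_trans (le_max_left _ _) hX
  have hX3 : 3 ≤ X := le_trans hx₀W hXW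
  have hX0 : 0 < X := by linarith
  have hX1 : 1 < X := by linarith
  set L : ℝ := Real.log X with hLdef
  have hLge : Real.exp 2 ≤ L := by
    rw [hLdef, Real.le_log_iff_exp_le hX0]; exact le_trans (le_max_right _ _) hX
  have hL0 : 0 < L := lt_of_lt_of_le (Real.exp_pos _) hLge
  have hL1 : 1 ≤ L := le_trans (by have := Real.add_one_le_exp (2 : ℝ); linarith) hLge
  set L₂ : ℝ := Real.log L with hL₂def
  have hL₂ge : 2 ≤ L₂ := by rw [hL₂def, Real.le_log_iff_exp_le hL0]; exact hLge
  have hL₂1 : 1 ≤ L₂ := by linarith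
  have hL₂0 : 0 < L₂ := by linarith
  have hexpL₂ : Real.exp L₂ = L := by rw [hL₂def]; exact Real.exp_log hL0
  have hL₂3 : 8 ≤ L₂ ^ 3 := by
    have h8 : (2 : ℝ) ^ 3 ≤ L₂ ^ 3 := pow_le_pow_left₀ (by norm_num) hL₂ge 3
    norm_num at h8; exact h8
  have hh0 : 0 < h := lt_of_lt_of_le (by positivity) hh1
  have hhle : h ≤ 1 := hh2.trans (by rw [div_le_one (by positivity)]; linarith)
  have hinvh : 1 / h ≤ 2 * L₂ ^ 3 := by
    rw [div_le_iff₀ hh0]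
    have := (div_le_iff₀ (by positivity : (0 : ℝ) < 2 * L₂ ^ 3)).1 hh1
    linarith
  have hh2' : h / 2 ≤ 1 / L₂ ^ 3 := by
    rw [div_le_iff₀ (by norm_num : (0 : ℝ) < 2)]
    calc h ≤ 2 / L₂ ^ 3 := hh2
      _ = 1 / L₂ ^ 3 * 2 := by ring
  -- `r`, `s`, `G(r)`, `M`
  set r : ℝ := (m : ℝ) / L₂ with hrdef
  have hr0 : 0 ≤ r := by positivity
  have hrR : r ≤ R := by rw [hrdef, div_le_iff₀ hL₂0]; exact hm
  set mx : ℝ := max (m : ℝ) 1 with hmxdef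
  have hmx1 : (1 : ℝ) ≤ mx := le_max_right _ _
  have hmx0 : (0 : ℝ) < mx := by linarith
  set s : ℝ := mx / L₂ with hsdef
  have hs0 : 0 < s := by positivity
  have hsL₂ : L₂ * s = mx := by rw [hsdef]; field_simp
  have hsR : s ≤ R + 1 := by
    rw [hsdef, div_le_iff₀ hL₂0, hmxdef]
    exact max_le (by nlinarith) (by nlinarith)
  set gr : ℝ := (selbergF 1 r).re / Real.Gamma (r + 1) with hgrdef
  have hgr : g ≤ gr := hgle r hr0 hrR
  have hgr0 : 0 < gr := lt_of_lt_of_le hg hgr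
  have hfac : (0 : ℝ) < m.factorial := by exact_mod_cast m.factorial_pos
  set Mk : ℝ := gr * X * L₂ ^ m / (m.factorial * L) with hMkdef
  have hMk0 : 0 < Mk := by positivity
  -- the common size `Q = X L₂^m (m+1)/(m! L L₂²)`, `M (m+1)/L₂² = G(r) Q`
  set Q : ℝ := X * L₂ ^ m * (m + 1) / (m.factorial * L * L₂ ^ 2) with hQdef
  have hQ0 : 0 < Q := by positivity
  have hMQ : Mk * ((m + 1) / L₂ ^ 2) = gr * Q := by
    rw [hMkdef, hQdef]; field_simp
  have hQg : Q ≤ 1 / g * (gr * Q) := by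
    rw [show 1 / g * (gr * Q) = (gr / g) * Q by ring]
    exact le_mul_of_one_le_left hQ0.le ((one_le_div hg).2 hgr)
  have hGr : G r = ((gr : ℝ) : ℂ) := G_ofReal r
  -- the constant `A = (1 + h/2) X / L`
  set A : ℂ := (((1 + h / 2) * X / L : ℝ) : ℂ) with hAdef
  have hA : ‖A‖ ≤ 2 * X / L := by
    rw [hAdef, Complex.norm_real, Real.norm_eq_abs, abs_of_pos (by positivity),
      div_le_div_iff_of_pos_right hL0]
    nlinarith
  -- the polynomial `W_z` and its weights
  set S : Finset ℕ := Finset.Ioc 0 ⌊X * (1 + h)⌋₊ with hSdef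
  set φ : ℕ → ℝ := fun n ↦ ((X * (1 + h) - n) - max (X - n) 0) / (h * X) with hφdef
  -- (1) on `|z| = s`: `‖W_z − A z G(z) e^{L₂ z}‖ ≤ ε`
  set ε : ℝ := CW * X * L ^ (s - 2) / h with hεdef
  have hWz : ∀ z ∈ sphere (0 : ℂ) s,
      ‖(∑ n ∈ S, omegaCoeff z n * ((φ n : ℝ) : ℂ)) - A * z * G z * exp (L₂ * z)‖ ≤ ε := by
    intro z hz
    have hzs : ‖z‖ = s := by simpa using hz
    have h1 := hW X hXW h hh0 hhle z (by rw [hzs]; exact hsR)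
    rw [shortMean_eq_sum z hX0 hh0] at h1
    have hcp : ((Real.log X : ℝ) : ℂ) ^ (z - 1) = exp ((L₂ : ℂ) * z) / (L : ℂ) := log_cpow_eq hX1 z
    have e : (1 + h / 2 : ℂ) * (selbergF 1 z / Complex.Gamma z) * X * (Real.log X : ℂ) ^ (z - 1) =
        A * z * G z * exp (L₂ * z) := by
      rw [selbergF_div_Gamma_eq, hcp, hAdef, hGdef]
      have hLc : (L : ℂ) ≠ 0 := ofReal_ne_zero.2 hL0.ne'
      push_cast
      field_simp
    rw [e] at h1
    have hrpow : L ^ (z.re - 2) ≤ L ^ (s - 2) :=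
      Real.rpow_le_rpow_of_exponent_le hL1 (by linarith [re_le_norm z])
    calc _ ≤ CW * X * Real.log X ^ (z.re - 2) / h := h1
      _ ≤ CW * X * L ^ (s - 2) / h := by rw [← hLdef]; gcongr
  -- (2) coefficient extraction
  have hΦc : ContinuousOn (fun z : ℂ ↦ A * z * G z * exp (L₂ * z)) (sphere (0 : ℂ) s) := by
    have : Continuous G := hGd.continuous
    fun_prop
  have hext : ‖(∑ n ∈ S.filter (fun n ↦ ω n = m + 1), ((φ n : ℝ) : ℂ)) -
      (2 * π * I)⁻¹ * ∮ z in C(0, s), (A * z * G z * exp (L₂ * z)) * z ^ (-(m + 1 + 1 : ℤ))‖ ≤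
      ε * (s ^ (m + 1))⁻¹ := by
    have := norm_coeff_sub_integral_le hs0 S (fun n ↦ ((φ n : ℝ) : ℂ)) (m + 1) hΦc hWz
    rwa [show (-(((m + 1 : ℕ) : ℤ) + 1)) = -(m + 1 + 1 : ℤ) by push_cast; ring] at this
  -- (3) the main-term integral and the remainder integral
  have hmain : (2 * π * I)⁻¹ * ∮ z in C(0, s), (A * z * G z * exp (L₂ * z)) * z ^ (-(m + 1 + 1 : ℤ)) =
      A * (G r * L₂ ^ m / m.factorial +
        (2 * π * I)⁻¹ * ∮ z in C(0, s),
          (G z - G r - (z - r) * deriv G r) * exp (L₂ * z) * z ^ (-(m + 1 : ℤ))) :=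
    mainTerm_integral_eq hGd hs0 hL₂0 A m
  have hremI : ‖(2 * π * I)⁻¹ * ∮ z in C(0, s),
      (G z - G r - (z - r) * deriv G r) * exp (L₂ * z) * z ^ (-(m + 1 : ℤ))‖ ≤
      Crem * ((m + 1) * L₂ ^ m / (L₂ ^ 2 * m.factorial)) := hrem L₂ hL₂1 m hm
  set RemI : ℂ := (2 * π * I)⁻¹ * ∮ z in C(0, s),
      (G z - G r - (z - r) * deriv G r) * exp (L₂ * z) * z ^ (-(m + 1 : ℤ)) with hRemIdef
  set IΦ : ℂ := (2 * π * I)⁻¹ * ∮ z in C(0, s), (A * z * G z * exp (L₂ * z)) * z ^ (-(m + 1 + 1 : ℤ))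
    with hIΦdef
  have hLc : (L : ℂ) ≠ 0 := ofReal_ne_zero.2 hL0.ne'
  have hfacc : (m.factorial : ℂ) ≠ 0 := by exact_mod_cast m.factorial_ne_zero
  have hmain' : IΦ = (((1 + h / 2) * Mk : ℝ) : ℂ) + A * RemI := by
    rw [hmain, hGr, hAdef, hMkdef]
    push_cast
    field_simp
  -- (4) the decomposition `W − M = (W − IΦ) + (h/2) M + A · RemI`
  have hWk : ((∑ n ∈ S.filter (fun n ↦ ω n = m + 1), φ n : ℝ) : ℂ) =
      ∑ n ∈ S.filter (fun n ↦ ω n = m + 1), ((φ n : ℝ) : ℂ) := by push_cast; rfl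
  have hdec : ((∑ n ∈ S.filter (fun n ↦ ω n = m + 1), φ n : ℝ) : ℂ) - (Mk : ℂ) =
      ((∑ n ∈ S.filter (fun n ↦ ω n = m + 1), ((φ n : ℝ) : ℂ)) - IΦ) +
        (((h / 2) * Mk : ℝ) : ℂ) + A * RemI := by
    rw [hWk, hmain']; push_cast; ring
  -- (5) the three bounds
  have hT1 : ε * (s ^ (m + 1))⁻¹ ≤ 1440 * Real.exp 1 * CW / g * (gr * Q) := by
    have hLs : L ^ (s - 2) = Real.exp mx / L ^ 2 := by
      rw [Real.rpow_sub hL0, Real.rpow_two, Real.rpow_def_of_pos hL0, ← hL₂def, hsL₂]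
    have hsinv : (s ^ (m + 1))⁻¹ = L₂ ^ (m + 1) / mx ^ (m + 1) := by
      rw [hsdef, div_pow, inv_div]
    have h6 : L₂ ^ 6 ≤ 720 * L := by rw [← hexpL₂]; exact pow_six_le_exp hL₂0.le
    have hE : Real.exp mx * m.factorial ≤ Real.exp 1 * (m + 1) * mx ^ (m + 1) := errTerm_arith m
    have hE' : Real.exp mx ≤ Real.exp 1 * (m + 1) * mx ^ (m + 1) / m.factorial := by
      rw [le_div_iff₀ hfac]; exact hE
    calc ε * (s ^ (m + 1))⁻¹
        = CW * X / L ^ 2 * (L₂ ^ (m + 1) / mx ^ (m + 1)) * Real.exp mx * (1 / h) := by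
          rw [hεdef, hLs, hsinv]; ring
      _ ≤ CW * X / L ^ 2 * (L₂ ^ (m + 1) / mx ^ (m + 1)) *
            (Real.exp 1 * (m + 1) * mx ^ (m + 1) / m.factorial) * (2 * L₂ ^ 3) := by gcongr
      _ = 2 * Real.exp 1 * CW * (X * L₂ ^ m * (m + 1) / (m.factorial * L * L₂ ^ 2)) *
            (L₂ ^ 6 / L) := by
          field_simp
          ring
      _ ≤ 2 * Real.exp 1 * CW * (X * L₂ ^ m * (m + 1) / (m.factorial * L * L₂ ^ 2)) * 720 := by
          gcongr
          rw [div_le_iff₀ hL0]; exact h6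
      _ = 1440 * Real.exp 1 * CW * Q := by rw [hQdef]; ring
      _ ≤ 1440 * Real.exp 1 * CW * (1 / g * (gr * Q)) := by gcongr
      _ = 1440 * Real.exp 1 * CW / g * (gr * Q) := by ring
  have hT2 : ‖(((h / 2) * Mk : ℝ) : ℂ)‖ ≤ 1 * (gr * Q) := by
    rw [Complex.norm_real, Real.norm_eq_abs, abs_of_pos (by positivity), one_mul, ← hMQ]
    have h3 : 1 / L₂ ^ 3 ≤ (m + 1) / L₂ ^ 2 := by
      rw [div_le_div_iff₀ (by positivity) (by positivity)]
      have : (0 : ℝ) ≤ m := m.cast_nonneg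
      nlinarith
    calc h / 2 * Mk ≤ 1 / L₂ ^ 3 * Mk := by gcongr
      _ ≤ (m + 1) / L₂ ^ 2 * Mk := by gcongr
      _ = Mk * ((m + 1) / L₂ ^ 2) := by ring
  have hT3 : ‖A * RemI‖ ≤ 2 * Crem / g * (gr * Q) := by
    rw [norm_mul]
    calc ‖A‖ * ‖RemI‖ ≤ (2 * X / L) * (Crem * ((m + 1) * L₂ ^ m / (L₂ ^ 2 * m.factorial))) :=
          mul_le_mul hA hremI (norm_nonneg _) (by positivity)
      _ = 2 * Crem * Q := by rw [hQdef]; field_simp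
      _ ≤ 2 * Crem * (1 / g * (gr * Q)) := by gcongr
      _ = 2 * Crem / g * (gr * Q) := by ring
  -- (6) conclusion
  have hfin : |(∑ n ∈ S.filter (fun n ↦ ω n = m + 1), φ n) - Mk| ≤
      (1 + 2 * Crem / g + 1440 * Real.exp 1 * CW / g) * (gr * Q) := by
    calc |(∑ n ∈ S.filter (fun n ↦ ω n = m + 1), φ n) - Mk|
        = ‖((∑ n ∈ S.filter (fun n ↦ ω n = m + 1), φ n : ℝ) : ℂ) - (Mk : ℂ)‖ := by
          rw [← ofReal_sub, Complex.norm_real, Real.norm_eq_abs]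
      _ = ‖((∑ n ∈ S.filter (fun n ↦ ω n = m + 1), ((φ n : ℝ) : ℂ)) - IΦ) +
            (((h / 2) * Mk : ℝ) : ℂ) + A * RemI‖ := by rw [hdec]
      _ ≤ ‖(∑ n ∈ S.filter (fun n ↦ ω n = m + 1), ((φ n : ℝ) : ℂ)) - IΦ‖ +
            ‖(((h / 2) * Mk : ℝ) : ℂ)‖ + ‖A * RemI‖ := norm_add₃_le
      _ ≤ 1440 * Real.exp 1 * CW / g * (gr * Q) + 1 * (gr * Q) + 2 * Crem / g * (gr * Q) := by
          gcongr
          exact hext.trans hT1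
      _ = (1 + 2 * Crem / g + 1440 * Real.exp 1 * CW / g) * (gr * Q) := by ring
  rw [← hMQ] at hfin
  rw [← mul_assoc] at hfin
  exact hfin


/-! ### The sandwich `W_k(x/(1+h), h) ≤ ρ_k(x) ≤ W_k(x, h)` (MV p. 180, last step) -/

/-- Upper half of the sandwich: `ρ_{m+1}(x) ≤ M + C M (m+1)/L₂²`, `M = G(m/L₂) x L₂^m/(m! log x)`.
[cite: MontgomeryVaughan2007, §7.4 p. 180] -/
theorem count_upper (R : ℝ) (hR : 0 < R) :
    ∃ C : ℝ, 0 ≤ C ∧ ∃ x₀ : ℝ, ∀ x : ℕ, x₀ ≤ (x : ℝ) → ∀ m : ℕ,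
      (m : ℝ) ≤ R * Real.log (Real.log x) →
      (distinctPrimeFactorCount x (m + 1) : ℝ) ≤
        (selbergF 1 ((m : ℝ) / Real.log (Real.log x) : ℝ)).re /
              Real.Gamma ((m : ℝ) / Real.log (Real.log x) + 1) *
            x * Real.log (Real.log x) ^ m / (m.factorial * Real.log x) +
        C * ((selbergF 1 ((m : ℝ) / Real.log (Real.log x) : ℝ)).re /
              Real.Gamma ((m : ℝ) / Real.log (Real.log x) + 1) *
            x * Real.log (Real.log x) ^ m / (m.factorial * Real.log x)) *
          ((m + 1) / Real.log (Real.log x) ^ 2) := by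
  obtain ⟨C, hC, x₁, hx₁, hcore⟩ := shortCoeff_asymp R hR
  refine ⟨C, hC, max x₁ (Real.exp (Real.exp 2)), fun x hx m hm ↦ ?_⟩
  have hxx₁ : x₁ ≤ (x : ℝ) := le_trans (le_max_left _ _) hx
  have hxe : Real.exp (Real.exp 2) ≤ (x : ℝ) := le_trans (le_max_right _ _) hx
  have hx0 : (0 : ℝ) < x := lt_of_lt_of_le (Real.exp_pos _) hxe
  have hxN : 0 < x := by exact_mod_cast hx0
  have hL : Real.exp 2 ≤ Real.log (x : ℝ) := by rw [Real.le_log_iff_exp_le hx0]; exact hxe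
  have hL0 : 0 < Real.log (x : ℝ) := lt_of_lt_of_le (Real.exp_pos _) hL
  set L₂ : ℝ := Real.log (Real.log (x : ℝ)) with hL₂def
  have hL₂2 : 2 ≤ L₂ := by rw [hL₂def, Real.le_log_iff_exp_le hL0]; exact hL
  have hL₂0 : 0 < L₂ := by linarith
  set h : ℝ := 1 / L₂ ^ 3 with hhdef
  have hh0 : 0 < h := by positivity
  have hp3 : 0 < L₂ ^ 3 := by positivity
  have hh1 : 1 / (2 * L₂ ^ 3) ≤ h := by
    rw [hhdef]; exact one_div_le_one_div_of_le hp3 (by linarith)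
  have hh2 : h ≤ 2 / L₂ ^ 3 := by
    rw [hhdef, div_le_div_iff_of_pos_right hp3]; norm_num
  have h1 := card_le_shortCoeff hxN hh0 (m + 1)
  have h2 := (abs_sub_le_iff.1 (hcore x hxx₁ h hh1 hh2 m hm)).1
  linarith

/-- Elementary comparisons between `x` and `X = x/(1+h)`, `h = (log log x)^{−3}`, and between the
corresponding `log` and `log log`. [folklore] -/
theorem aux_compare {x L L₂ h X : ℝ} (hx : Real.exp (Real.exp 2) ≤ x) (hL : L = Real.log x)
    (hL₂ : L₂ = Real.log L) (hh : h = 1 / L₂ ^ 3) (hX : X = x / (1 + h)) :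
    2 ≤ L₂ ∧ 3 ≤ L ∧ 0 < h ∧ h ≤ 1 / 8 ∧ x / 2 ≤ X ∧ X ≤ x ∧
    Real.log X ≤ L ∧ (1 - h) * L ≤ Real.log X ∧
    Real.log (Real.log X) ≤ L₂ ∧ L₂ - 2 * h / L ≤ Real.log (Real.log X) ∧
    L₂ ≤ 2 * Real.log (Real.log X) ∧
    1 / (2 * Real.log (Real.log X) ^ 3) ≤ h ∧ h ≤ 2 / Real.log (Real.log X) ^ 3 := by
  have hx0 : 0 < x := lt_of_lt_of_le (Real.exp_pos _) hx
  have hLge : Real.exp 2 ≤ L := by rw [hL, Real.le_log_iff_exp_le hx0]; exact hx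
  have he2 : (3 : ℝ) ≤ Real.exp 2 := by have := Real.add_one_le_exp (2 : ℝ); linarith
  have hL3 : 3 ≤ L := he2.trans hLge
  have hL0 : 0 < L := by linarith
  have hL₂ge : 2 ≤ L₂ := by rw [hL₂, Real.le_log_iff_exp_le hL0]; exact hLge
  have hL₂0 : 0 < L₂ := by linarith
  have hL₂3 : 8 ≤ L₂ ^ 3 := by
    have h8 : (2 : ℝ) ^ 3 ≤ L₂ ^ 3 := pow_le_pow_left₀ (by norm_num) hL₂ge 3
    norm_num at h8; exact h8
  have hp3 : 0 < L₂ ^ 3 := by positivity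
  have hh0 : 0 < h := by rw [hh]; positivity
  have hh8 : h ≤ 1 / 8 := by rw [hh]; exact one_div_le_one_div_of_le (by norm_num) hL₂3
  have h1h : 0 < 1 + h := by linarith
  have hXle : X ≤ x := by rw [hX]; exact div_le_self hx0.le (by linarith)
  have hXge : x / 2 ≤ X := by rw [hX]; exact div_le_div_of_nonneg_left hx0.le h1h (by linarith)
  have hX0 : 0 < X := by linarith
  -- `log X`
  have hlogX : Real.log X = L - Real.log (1 + h) := by rw [hX, Real.log_div hx0.ne' h1h.ne', hL]
  have hl1 : 0 ≤ Real.log (1 + h) := Real.log_nonneg (by linarith)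
  have hl2 : Real.log (1 + h) ≤ h := by have := Real.log_le_sub_one_of_pos h1h; linarith
  have hlogXle : Real.log X ≤ L := by rw [hlogX]; linarith
  have hlogXge : L - h ≤ Real.log X := by rw [hlogX]; linarith
  have hlogXge' : (1 - h) * L ≤ Real.log X := by
    have : h * 1 ≤ h * L := by gcongr; linarith
    nlinarith
  have hlogX0 : 0 < Real.log X := by linarith
  -- `log log X`
  have hL₂'le : Real.log (Real.log X) ≤ L₂ := by rw [hL₂]; exact Real.log_le_log hlogX0 hlogXle
  set v : ℝ := h / L with hv
  have hv0 : 0 ≤ v := by positivity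
  have hvhalf : v ≤ 1 / 2 := by
    rw [hv, div_le_iff₀ hL0]; linarith
  have hlog1v : -2 * v ≤ Real.log (1 - v) := by
    have h1 := Real.one_sub_inv_le_log_of_pos (by linarith : (0 : ℝ) < 1 - v)
    have h2 : (1 - v)⁻¹ ≤ 1 + 2 * v := by
      rw [inv_le_iff_one_le_mul₀ (by linarith)]; nlinarith
    linarith
  have hL₂'ge : L₂ - 2 * h / L ≤ Real.log (Real.log X) := by
    have e : L - h = L * (1 - v) := by rw [hv]; field_simp
    have h1 : Real.log (L - h) ≤ Real.log (Real.log X) := Real.log_le_log (by linarith) hlogXge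
    rw [e, Real.log_mul hL0.ne' (by linarith), ← hL₂] at h1
    have : 2 * h / L = 2 * v := by rw [hv]; ring
    linarith
  have h2hL : 2 * h / L ≤ 1 / 12 := by
    rw [div_le_div_iff₀ hL0 (by norm_num)]; linarith
  have hL₂'half : L₂ ≤ 2 * Real.log (Real.log X) := by linarith
  have hL₂'0 : 0 < Real.log (Real.log X) := by linarith
  have hp3' : 0 < Real.log (Real.log X) ^ 3 := by positivity
  refine ⟨hL₂ge, hL3, hh0, hh8, hXge, hXle, hlogXle, hlogXge', hL₂'le, hL₂'ge, hL₂'half, ?_, ?_⟩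
  · -- `1/(2 L₂'³) ≤ 1/L₂³`
    rw [hh]
    have h78 : 7 / 8 * L₂ ≤ Real.log (Real.log X) := by linarith
    have hcube : (7 / 8 * L₂) ^ 3 ≤ Real.log (Real.log X) ^ 3 :=
      pow_le_pow_left₀ (by positivity) h78 3
    rw [div_le_div_iff₀ (by positivity) hp3]
    have e78 : (7 / 8 * L₂) ^ 3 = 343 / 512 * L₂ ^ 3 := by ring
    linarith
  · rw [hh]
    have hcube : Real.log (Real.log X) ^ 3 ≤ L₂ ^ 3 := pow_le_pow_left₀ hL₂'0.le hL₂'le 3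
    calc 1 / L₂ ^ 3 ≤ 1 / Real.log (Real.log X) ^ 3 := one_div_le_one_div_of_le hp3' hcube
      _ ≤ 2 / Real.log (Real.log X) ^ 3 := by gcongr; norm_num

set_option maxHeartbeats 1600000 in
/-- Lower half of the sandwich: `M − C M (m+1)/L₂² ≤ ρ_{m+1}(x)`, via `W_{m+1}(x/(1+h), h) ≤ ρ_{m+1}(x)`
and the comparison `M(x/(1+h)) = M(x)(1 + O(h))`. [cite: MontgomeryVaughan2007, §7.4 p. 180] -/
theorem count_lower (R : ℝ) (hR : 0 < R) :
    ∃ C : ℝ, 0 ≤ C ∧ ∃ x₀ : ℝ, ∀ x : ℕ, x₀ ≤ (x : ℝ) → ∀ m : ℕ,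
      (m : ℝ) ≤ R * Real.log (Real.log x) →
        (selbergF 1 ((m : ℝ) / Real.log (Real.log x) : ℝ)).re /
              Real.Gamma ((m : ℝ) / Real.log (Real.log x) + 1) *
            x * Real.log (Real.log x) ^ m / (m.factorial * Real.log x) -
        C * ((selbergF 1 ((m : ℝ) / Real.log (Real.log x) : ℝ)).re /
              Real.Gamma ((m : ℝ) / Real.log (Real.log x) + 1) *
            x * Real.log (Real.log x) ^ m / (m.factorial * Real.log x)) *
          ((m + 1) / Real.log (Real.log x) ^ 2) ≤
      (distinctPrimeFactorCount x (m + 1) : ℝ) := by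
  obtain ⟨C₁, hC₁, x₁, hx₁3, hcore⟩ := shortCoeff_asymp (2 * R) (by linarith)
  obtain ⟨g, hg, hgle⟩ := exists_G_lower (R := 2 * R) (by linarith)
  obtain ⟨Λ, hΛ, hlip⟩ := exists_G_lipschitz (R := 2 * R) (by linarith)
  refine ⟨3 + 16 * C₁, by positivity,
    max (2 * x₁) (max (Real.exp (Real.exp 2)) (Real.exp (max (2 * R) (2 * Λ * R / g)))),
    fun x hx m hm ↦ ?_⟩
  have hx2x₁ : 2 * x₁ ≤ (x : ℝ) := le_trans (le_max_left _ _) hx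
  have hxe : Real.exp (Real.exp 2) ≤ (x : ℝ) :=
    le_trans (le_trans (le_max_left _ _) (le_max_right _ _)) hx
  have hxT : Real.exp (max (2 * R) (2 * Λ * R / g)) ≤ (x : ℝ) :=
    le_trans (le_trans (le_max_right _ _) (le_max_right _ _)) hx
  have hx0 : (0 : ℝ) < x := lt_of_lt_of_le (Real.exp_pos _) hxe
  have hxN : 0 < x := by exact_mod_cast hx0
  set L : ℝ := Real.log (x : ℝ) with hLdef
  set L₂ : ℝ := Real.log L with hL₂def
  set h : ℝ := 1 / L₂ ^ 3 with hhdef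
  set X : ℝ := (x : ℝ) / (1 + h) with hXdef
  obtain ⟨hL₂2, hL3, hh0, hh8, hXlo, hXhi, hlogXhi, hlogXlo, hL₂'hi, hL₂'lo, hL₂'2, hh1, hh2⟩ :=
    aux_compare hxe hLdef hL₂def hhdef hXdef
  set L' : ℝ := Real.log X with hL'def
  set L₂' : ℝ := Real.log L' with hL₂'def
  have hL0 : 0 < L := by linarith
  have hL₂0 : 0 < L₂ := by linarith
  have hL₂'1 : 1 ≤ L₂' := by linarith
  have hL₂'0 : 0 < L₂' := by linarith
  have hL'0 : 0 < L' := lt_of_lt_of_le (mul_pos (by linarith) (by linarith)) hlogXlo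
  have hX0 : 0 < X := by linarith
  have hLT : max (2 * R) (2 * Λ * R / g) ≤ L := by
    rw [hLdef, Real.le_log_iff_exp_le hx0]; exact hxT
  have hL2R : 2 * R ≤ L := le_trans (le_max_left _ _) hLT
  have hLΛ : 2 * Λ * R / g ≤ L := le_trans (le_max_right _ _) hLT
  have hm0 : (0 : ℝ) ≤ m := m.cast_nonneg
  have hfac : (0 : ℝ) < m.factorial := by exact_mod_cast m.factorial_pos
  -- the smoothed count at `X` and the core asymptotic there
  have hX₁ : x₁ ≤ X := by linarith
  have hm' : (m : ℝ) ≤ 2 * R * L₂' :=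
    hm.trans (by calc R * L₂ ≤ R * (2 * L₂') := by gcongr
                   _ = 2 * R * L₂' := by ring)
  have hW := hcore X hX₁ h hh1 hh2 m hm'
  have hcount := shortCoeff_le_card hxN hh0 (m + 1)
  -- the two main terms
  set r : ℝ := (m : ℝ) / L₂ with hrdef
  set r' : ℝ := (m : ℝ) / L₂' with hr'def
  have hr0 : 0 ≤ r := by positivity
  have hrR : r ≤ R := by rw [hrdef, div_le_iff₀ hL₂0]; exact hm
  have hr'0 : 0 ≤ r' := by positivity
  have hr'R : r' ≤ 2 * R := by rw [hr'def, div_le_iff₀ hL₂'0]; exact hm'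
  set gr : ℝ := (selbergF 1 r).re / Real.Gamma (r + 1) with hgrdef
  set gr' : ℝ := (selbergF 1 r').re / Real.Gamma (r' + 1) with hgr'def
  have hgr : g ≤ gr := hgle r hr0 (by linarith)
  have hgr0 : 0 < gr := lt_of_lt_of_le hg hgr
  set M : ℝ := gr * x * L₂ ^ m / (m.factorial * L) with hMdef
  set M' : ℝ := gr' * X * L₂' ^ m / (m.factorial * L') with hM'def
  have hM0 : 0 < M := by positivity
  -- `|r' − r| ≤ 2 R h / L` and the Lipschitz comparison of `G`
  have hdr : |r' - r| ≤ 2 * R * h / L := by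
    have e : r' - r = m * (L₂ - L₂') / (L₂ * L₂') := by
      rw [hrdef, hr'def]; field_simp
    rw [e, abs_of_nonneg (div_nonneg (mul_nonneg hm0 (by linarith)) (by positivity))]
    rw [div_le_div_iff₀ (by positivity) hL0]
    have h1 : (m : ℝ) * (L₂ - L₂') ≤ R * L₂ * (2 * h / L) :=
      mul_le_mul hm (by linarith) (by linarith) (by positivity)
    have h2 : R * L₂ * (2 * h / L) * L = 2 * R * h * L₂ := by field_simp
    calc (m : ℝ) * (L₂ - L₂') * L ≤ R * L₂ * (2 * h / L) * L := by gcongr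
      _ = 2 * R * h * L₂ := h2
      _ = 2 * R * h * (L₂ * 1) := by ring
      _ ≤ 2 * R * h * (L₂ * L₂') := by gcongr
  have hΛh : Λ * |r' - r| ≤ g * h := by
    calc Λ * |r' - r| ≤ Λ * (2 * R * h / L) := by gcongr
      _ = (2 * Λ * R / g) / L * (g * h) := by field_simp
      _ ≤ 1 * (g * h) := by
          gcongr
          rw [div_le_one hL0]; exact hLΛ
      _ = g * h := one_mul _
  have hgg := hlip r r' hr0 (by linarith) hr'0 hr'R
  have hgr'lo : gr * (1 - h) ≤ gr' := by
    have : gr - gr' ≤ gr * h := by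
      calc gr - gr' ≤ |gr' - gr| := by rw [abs_sub_comm]; exact le_abs_self _
        _ ≤ g * h := hgg.trans hΛh
        _ ≤ gr * h := by gcongr
    linarith
  have hgr'hi : gr' ≤ gr * (1 + h) := by
    have : gr' - gr ≤ gr * h := by
      calc gr' - gr ≤ |gr' - gr| := le_abs_self _
        _ ≤ g * h := hgg.trans hΛh
        _ ≤ gr * h := by gcongr
    linarith
  have hgr'0 : 0 < gr' := lt_of_lt_of_le (mul_pos hgr0 (by linarith)) hgr'lo
  have hM'0 : 0 < M' := by positivity
  -- powers of `L₂'`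
  have hpowhi : L₂' ^ m ≤ L₂ ^ m := pow_le_pow_left₀ hL₂'0.le hL₂'hi m
  have hpowlo : L₂ ^ m * (1 - h) ≤ L₂' ^ m := by
    set v : ℝ := 2 * h / (L * L₂) with hv
    have hv0 : 0 ≤ v := by positivity
    have hv1 : L₂ * (1 - v) ≤ L₂' := by
      have : L₂ * (1 - v) = L₂ - 2 * h / L := by rw [hv]; field_simp
      rw [this]; exact hL₂'lo
    have hvle : v ≤ 1 := by
      rw [hv, div_le_one (by positivity)]
      have h6 : (3 : ℝ) * 2 ≤ L * L₂ := mul_le_mul hL3 hL₂2 (by norm_num) hL0.le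
      linarith
    have hmv : (m : ℝ) * v ≤ h := by
      rw [hv]
      calc (m : ℝ) * (2 * h / (L * L₂)) ≤ R * L₂ * (2 * h / (L * L₂)) := by gcongr
        _ = (2 * R) / L * h := by field_simp
        _ ≤ 1 * h := by gcongr; rw [div_le_one hL0]; exact hL2R
        _ = h := one_mul h
    have hbern : 1 + (m : ℝ) * (-v) ≤ (1 + (-v)) ^ m :=
      one_add_le_pow_of_two_add_nonneg (by linarith) m
    calc L₂ ^ m * (1 - h) ≤ L₂ ^ m * (1 + (m : ℝ) * (-v)) := by gcongr; linarith
      _ ≤ L₂ ^ m * (1 + (-v)) ^ m := by gcongr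
      _ = (L₂ * (1 - v)) ^ m := by rw [mul_pow]; ring
      _ ≤ L₂' ^ m := pow_le_pow_left₀ (mul_nonneg hL₂0.le (by linarith)) hv1 m
  -- `M' ≥ M(1−h)³ ≥ M(1 − 3h)` and `M' ≤ 2M`
  have hXlo' : (x : ℝ) * (1 - h) ≤ X := by
    rw [hXdef, le_div_iff₀ (by linarith)]
    calc (x : ℝ) * (1 - h) * (1 + h) = x * (1 - h ^ 2) := by ring
      _ ≤ x * 1 := by gcongr; linarith [sq_nonneg h]
      _ = x := mul_one _
  have hM'lo : M * (1 - h) ^ 3 ≤ M' := by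
    have i12 : (gr * (1 - h)) * ((x : ℝ) * (1 - h)) ≤ gr' * X :=
      mul_le_mul hgr'lo hXlo' (mul_nonneg hx0.le (by linarith)) hgr'0.le
    have i123 : (gr * (1 - h)) * ((x : ℝ) * (1 - h)) * (L₂ ^ m * (1 - h)) ≤ gr' * X * L₂' ^ m :=
      mul_le_mul i12 hpowlo (mul_nonneg (by positivity) (by linarith)) (by positivity)
    calc M * (1 - h) ^ 3 = (gr * (1 - h)) * ((x : ℝ) * (1 - h)) * (L₂ ^ m * (1 - h)) /
          (m.factorial * L) := by rw [hMdef]; ring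
      _ ≤ gr' * X * L₂' ^ m / (m.factorial * L) := div_le_div_of_nonneg_right i123 (by positivity)
      _ ≤ gr' * X * L₂' ^ m / (m.factorial * L') := by
          apply div_le_div_of_nonneg_left (by positivity) (by positivity)
          gcongr
  have hM'lo' : M - 3 * (M * h) ≤ M' := by
    have h3h : 1 - 3 * h ≤ (1 - h) ^ 3 := by
      have e : (1 - h) ^ 3 = 1 - 3 * h + h ^ 2 * (3 - h) := by ring
      have : 0 ≤ h ^ 2 * (3 - h) := mul_nonneg (sq_nonneg h) (by linarith)
      linarith
    calc M - 3 * (M * h) = M * (1 - 3 * h) := by ring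
      _ ≤ M * (1 - h) ^ 3 := by gcongr
      _ ≤ M' := hM'lo
  have hM'hi : M' ≤ 2 * M := by
    calc M' ≤ (gr * (1 + h)) * x * L₂ ^ m / (m.factorial * ((1 - h) * L)) := by
          rw [hM'def]
          gcongr
          · exact mul_pos hfac (mul_pos (by linarith) hL0)
      _ = M * ((1 + h) / (1 - h)) := by
          rw [hMdef]
          have : (1 - h) ≠ 0 := by linarith
          field_simp
      _ ≤ M * 2 := by
          gcongr
          rw [div_le_iff₀ (by linarith)]; linarith
      _ = 2 * M := by ring
  -- the error term at `X` in terms of `M` and `L₂`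
  have hq : 1 / L₂' ^ 2 ≤ 4 / L₂ ^ 2 := by
    rw [div_le_div_iff₀ (by positivity) (by positivity)]
    have hsq : L₂ ^ 2 ≤ (2 * L₂') ^ 2 := pow_le_pow_left₀ hL₂0.le hL₂'2 2
    linarith
  have herr : C₁ * M' * ((m + 1) / L₂' ^ 2) ≤ 8 * (C₁ * (M * ((m + 1) / L₂ ^ 2))) := by
    calc C₁ * M' * ((m + 1) / L₂' ^ 2) = C₁ * M' * ((m + 1) * (1 / L₂' ^ 2)) := by ring
      _ ≤ C₁ * (2 * M) * ((m + 1) * (4 / L₂ ^ 2)) := by gcongr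
      _ = 8 * (C₁ * (M * ((m + 1) / L₂ ^ 2))) := by ring
  have hhq : h ≤ (m + 1) / L₂ ^ 2 := by
    rw [hhdef, div_le_div_iff₀ (by positivity) (by positivity)]
    have h1 : (1 : ℝ) ≤ L₂ * (m + 1) := by
      calc (1 : ℝ) ≤ L₂ := by linarith
        _ = L₂ * 1 := (mul_one _).symm
        _ ≤ L₂ * (m + 1) := by gcongr; linarith
    have : L₂ ^ 2 * 1 ≤ L₂ ^ 2 * (L₂ * (m + 1)) := mul_le_mul_of_nonneg_left h1 (by positivity)
    linarith
  have hW' := (abs_sub_le_iff.1 hW).2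
  -- conclusion
  have hMq : 0 ≤ M * ((m + 1) / L₂ ^ 2) := by positivity
  have hCMq : 0 ≤ C₁ * (M * ((m + 1) / L₂ ^ 2)) := by positivity
  have hMh : M * h ≤ M * ((m + 1) / L₂ ^ 2) := by gcongr
  have key : M - 3 * (M * ((m + 1) / L₂ ^ 2)) - 16 * (C₁ * (M * ((m + 1) / L₂ ^ 2))) ≤
      (distinctPrimeFactorCount x (m + 1) : ℝ) := by linarith
  calc _ = M - 3 * (M * ((m + 1) / L₂ ^ 2)) - 16 * (C₁ * (M * ((m + 1) / L₂ ^ 2))) := by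
        rw [hMdef]; ring
    _ ≤ _ := key

/-! ### Replacing `F(1,r)` by the finite Euler product `∏_{p ≤ x}` -/

/-- `|Re F(1,r) − F_x(r)| ≤ |F_x(r)| · C x^{−1/2}` for `|r| ≤ R`, `x ≥ x₀`.
[cite: MontgomeryVaughan2007, §7.4.1 Exercise 3(a)] -/
theorem abs_re_selbergF_sub_satheSelbergF_le (R : ℝ) :
    ∃ C : ℝ, 0 ≤ C ∧ ∃ x₀ : ℕ, ∀ x : ℕ, x₀ ≤ x → ∀ r : ℝ, |r| ≤ R →
      |(selbergF 1 r).re - satheSelbergF x r| ≤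
        |satheSelbergF x r| * (C * (x : ℝ) ^ (-(1 / 2 : ℝ))) := by
  obtain ⟨C, hC, x₀, h⟩ := exists_norm_selbergF_one_sub_prod_le R
  refine ⟨C, hC, x₀, fun x hx r hr ↦ ?_⟩
  have h1 := h x hx r (by rwa [Complex.norm_real, Real.norm_eq_abs])
  rw [prod_eulerFactor_one_ofReal x r] at h1
  calc |(selbergF 1 r).re - satheSelbergF x r|
      = |(selbergF 1 r - ((satheSelbergF x r : ℝ) : ℂ)).re| := by simp
    _ ≤ ‖selbergF 1 r - ((satheSelbergF x r : ℝ) : ℂ)‖ := Complex.abs_re_le_norm _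
    _ ≤ ‖((satheSelbergF x r : ℝ) : ℂ)‖ * (C * (x : ℝ) ^ (-(1 / 2 : ℝ))) := h1
    _ = |satheSelbergF x r| * (C * (x : ℝ) ^ (-(1 / 2 : ℝ))) := by
        rw [Complex.norm_real, Real.norm_eq_abs]

/-- `x^{−1/2} ≤ 4/(log log x)²` for `x ≥ e^{e²}`. [folklore] -/
theorem rpow_neg_half_le {x : ℝ} (hx : Real.exp (Real.exp 2) ≤ x) :
    x ^ (-(1 / 2 : ℝ)) ≤ 4 / Real.log (Real.log x) ^ 2 := by
  have hx0 : 0 < x := lt_of_lt_of_le (Real.exp_pos _) hx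
  set L : ℝ := Real.log x with hLdef
  set L₂ : ℝ := Real.log L with hL₂def
  have hL : Real.exp 2 ≤ L := by rw [hLdef, Real.le_log_iff_exp_le hx0]; exact hx
  have hL0 : 0 < L := lt_of_lt_of_le (Real.exp_pos _) hL
  have hL₂ : 2 ≤ L₂ := by rw [hL₂def, Real.le_log_iff_exp_le hL0]; exact hL
  have e : x ^ (-(1 / 2 : ℝ)) = (Real.exp (L / 2))⁻¹ := by
    rw [Real.rpow_neg hx0.le, Real.rpow_def_of_pos hx0, hLdef]
    congr 1; ring_nf
  have h1 : L / 2 + 1 ≤ Real.exp (L / 2) := Real.add_one_le_exp _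
  have h2 : L₂ ^ 2 / 2 ≤ L := by
    have h3 := Real.pow_div_factorial_le_exp (x := L₂) (by linarith) 2
    rw [show (Nat.factorial 2 : ℝ) = 2 by norm_num [Nat.factorial] ] at h3
    have h4 : Real.exp L₂ = L := by rw [hL₂def]; exact Real.exp_log hL0
    linarith
  rw [e, inv_eq_one_div, div_le_div_iff₀ (Real.exp_pos _) (by positivity)]
  linarith

end SatheSelberg

/-! ### The Sathe–Selberg formula for `ω` -/

open SatheSelberg in
set_option maxHeartbeats 1600000 in
/-- **The Sathe–Selberg formula for `ω`** (Montgomery–Vaughan 2007, §7.4.1 Exercise 3(c); Selberg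
1954): discharge of the named fact `MontgomeryVaughan2007_exercise_7_4_3c`. For every `R > 0` there
are `C`, `x₀` with `|ρ_k(x) − M_k(x)| ≤ C M_k(x) k/(log log x)²` for `x ≥ x₀`, `1 ≤ k ≤ R log log x`,
`M_k(x) = G_x((k−1)/log log x) x (log log x)^{k−1}/((k−1)! log x)`. The proof is MV's proof of
Theorem 7.19 (pp. 180–181) on top of the Selberg–Delange asymptotic
`SatheSelberg.rieszMean_omegaCoeff_asymp`. [cite: MontgomeryVaughan2007, §7.4.1 Exercise 3(c)] -/
theorem MontgomeryVaughan2007_exercise_7_4_3c_holds : MontgomeryVaughan2007_exercise_7_4_3c := by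
  intro R hR
  obtain ⟨Cu, hCu, xu, hup⟩ := count_upper R hR
  obtain ⟨Cl, hCl, xl, hlow⟩ := count_lower R hR
  obtain ⟨Cp, hCp, xp, hswap⟩ := abs_re_selbergF_sub_satheSelbergF_le R
  refine ⟨max Cu Cl * (1 + Cp) + 4 * Cp,
    max xp (max ⌈xu⌉₊ (max ⌈xl⌉₊ ⌈Real.exp (Real.exp 2)⌉₊)), fun x hx k hk hkR ↦ ?_⟩
  -- thresholds
  have hxp : xp ≤ x := le_trans (le_max_left _ _) hx
  have hxu : xu ≤ (x : ℝ) := (Nat.le_ceil xu).trans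
    (by exact_mod_cast le_trans (le_trans (le_max_left _ _) (le_max_right _ _)) hx)
  have hxl : xl ≤ (x : ℝ) := (Nat.le_ceil xl).trans (by
    exact_mod_cast le_trans (le_trans (le_trans (le_max_left _ _) (le_max_right _ _))
      (le_max_right _ _)) hx)
  have hxe : Real.exp (Real.exp 2) ≤ (x : ℝ) := (Nat.le_ceil _).trans (by
    exact_mod_cast le_trans (le_trans (le_trans (le_max_right _ _) (le_max_right _ _))
      (le_max_right _ _)) hx)
  have hx0 : (0 : ℝ) < x := lt_of_lt_of_le (Real.exp_pos _) hxe
  -- `k = m + 1`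
  obtain ⟨m, rfl⟩ : ∃ m, k = m + 1 := ⟨k - 1, by omega⟩
  have e1 : ((m + 1 : ℕ) : ℝ) - 1 = m := by push_cast; ring
  have e2 : m + 1 - 1 = m := by omega
  have e3 : ((m + 1 : ℕ) : ℝ) = (m : ℝ) + 1 := by push_cast; ring
  rw [e3] at hkR
  rw [e1, e2, e3, satheSelbergG_apply]
  have hL : Real.exp 2 ≤ Real.log (x : ℝ) := by rw [Real.le_log_iff_exp_le hx0]; exact hxe
  have hL0 : 0 < Real.log (x : ℝ) := lt_of_lt_of_le (Real.exp_pos _) hL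
  have hL₂2 : 2 ≤ Real.log (Real.log (x : ℝ)) := by rw [Real.le_log_iff_exp_le hL0]; exact hL
  have hm : (m : ℝ) ≤ R * Real.log (Real.log (x : ℝ)) := by linarith
  have hm0 : (0 : ℝ) ≤ m := m.cast_nonneg
  have hr0 : 0 ≤ (m : ℝ) / Real.log (Real.log (x : ℝ)) := by positivity
  have hrR : (m : ℝ) / Real.log (Real.log (x : ℝ)) ≤ R := by
    rw [div_le_iff₀ (by linarith)]; exact hm
  -- the three inputs, stated before abbreviating
  have hU := hup x hxu m hm
  have hLo := hlow x hxl m hm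
  have hS := hswap x hxp ((m : ℝ) / Real.log (Real.log (x : ℝ))) (by rwa [abs_of_nonneg hr0])
  have hx4 := rpow_neg_half_le hxe
  have hFx := satheSelbergF_pos x hr0
  have hFr := selbergF_one_ofReal_re_pos hr0
  have hΓ : 0 < Real.Gamma ((m : ℝ) / Real.log (Real.log (x : ℝ)) + 1) :=
    Real.Gamma_pos_of_pos (by linarith)
  -- abbreviations
  set L : ℝ := Real.log (x : ℝ) with hLdef
  set L₂ : ℝ := Real.log L with hL₂def
  set r : ℝ := (m : ℝ) / L₂ with hrdef
  set Fr : ℝ := (selbergF 1 r).re with hFrdef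
  set Fx : ℝ := satheSelbergF x r with hFxdef
  set Γr : ℝ := Real.Gamma (r + 1) with hΓdef
  set B : ℝ := (x : ℝ) * L₂ ^ m / (m.factorial * L) with hBdef
  set q : ℝ := ((m : ℝ) + 1) / L₂ ^ 2 with hqdef
  set ρ : ℝ := (distinctPrimeFactorCount x (m + 1) : ℝ) with hρdef
  have hL₂0 : 0 < L₂ := by linarith
  have hfac : (0 : ℝ) < m.factorial := by exact_mod_cast m.factorial_pos
  have hB0 : 0 < B := by positivity
  have hq0 : 0 < q := by positivity
  have hq1 : 1 / L₂ ^ 2 ≤ q := by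
    rw [hqdef]; apply div_le_div_of_nonneg_right (by linarith) (by positivity)
  rw [abs_of_pos hFx] at hS
  -- `|ρ − (Fr/Γr) B| ≤ C₂ (Fr/Γr) B q`
  have hE : Fr / Γr * x * L₂ ^ m / (m.factorial * L) = Fr / Γr * B := by rw [hBdef]; ring
  rw [hE] at hU hLo
  have hPB0 : 0 ≤ Fr / Γr * B := by positivity
  have h1 : |ρ - Fr / Γr * B| ≤ max Cu Cl * (Fr / Γr * B) * q := by
    rw [abs_sub_le_iff]
    constructor
    · calc ρ - Fr / Γr * B ≤ Cu * (Fr / Γr * B) * q := by linarith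
        _ ≤ max Cu Cl * (Fr / Γr * B) * q := by gcongr; exact le_max_left _ _
    · calc Fr / Γr * B - ρ ≤ Cl * (Fr / Γr * B) * q := by linarith
        _ ≤ max Cu Cl * (Fr / Γr * B) * q := by gcongr; exact le_max_right _ _
  -- `|Fr − Fx| ≤ Fx · 4Cp/L₂²`
  have ht : Cp * (x : ℝ) ^ (-(1 / 2 : ℝ)) ≤ 4 * Cp / L₂ ^ 2 := by
    calc Cp * (x : ℝ) ^ (-(1 / 2 : ℝ)) ≤ Cp * (4 / L₂ ^ 2) := by gcongr
      _ = 4 * Cp / L₂ ^ 2 := by ring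
  have h2 : |Fr - Fx| ≤ Fx * (4 * Cp / L₂ ^ 2) := hS.trans (by gcongr)
  have h2' : |Fr / Γr - Fx / Γr| ≤ Fx / Γr * (4 * Cp / L₂ ^ 2) := by
    rw [← sub_div, abs_div, abs_of_pos hΓ, div_mul_eq_mul_div]
    exact div_le_div_of_nonneg_right h2 hΓ.le
  have htq : 4 * Cp / L₂ ^ 2 ≤ 4 * Cp * q := by
    calc 4 * Cp / L₂ ^ 2 = 4 * Cp * (1 / L₂ ^ 2) := by ring
      _ ≤ 4 * Cp * q := by gcongr
  have htC : 4 * Cp / L₂ ^ 2 ≤ Cp := by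
    rw [div_le_iff₀ (by positivity)]
    have h4 : (2 : ℝ) ^ 2 ≤ L₂ ^ 2 := pow_le_pow_left₀ (by norm_num) hL₂2 2
    calc 4 * Cp = Cp * 2 ^ 2 := by ring
      _ ≤ Cp * L₂ ^ 2 := by gcongr
  have hPf0 : 0 < Fx / Γr := div_pos hFx hΓ
  have h3 : Fr / Γr ≤ Fx / Γr * (1 + Cp) := by
    have := (abs_sub_le_iff.1 h2').1
    calc Fr / Γr ≤ Fx / Γr + Fx / Γr * (4 * Cp / L₂ ^ 2) := by linarith
      _ ≤ Fx / Γr + Fx / Γr * Cp := by gcongr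
      _ = Fx / Γr * (1 + Cp) := by ring
  -- conclusion
  calc |ρ - Fx / Γr * B| ≤ |ρ - Fr / Γr * B| + |Fr / Γr * B - Fx / Γr * B| := abs_sub_le _ _ _
    _ = |ρ - Fr / Γr * B| + |Fr / Γr - Fx / Γr| * B := by
        rw [← sub_mul, abs_mul, abs_of_pos hB0]
    _ ≤ max Cu Cl * (Fr / Γr * B) * q + Fx / Γr * (4 * Cp / L₂ ^ 2) * B := by gcongr
    _ ≤ max Cu Cl * ((Fx / Γr * (1 + Cp)) * B) * q + Fx / Γr * (4 * Cp * q) * B := by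
        gcongr
    _ = (max Cu Cl * (1 + Cp) + 4 * Cp) * (Fx / Γr * B) * q := by ring

end Literature.NumberTheory.LFunctions
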